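import Mathlib
import Literature.AlgebraicGeometry.DeterminantalHypersurfaces.MonicPencilRealZero
import HarnessLib

/-!
# Netzer–Thom 2012, §2: the size of monic symmetric determinantal representations

Source: T. Netzer, A. Thom, *Polynomials with and without determinantal representations*,
Linear Algebra Appl. 437 (2012) 1579–1595, doi:10.1016/j.laa.2012.04.043, arXiv:1008.1931
[cite: NetzerThom2012, §2 "On the size of linear matrix polynomials"].

Setting of the paper (§1): a *linear matrix polynomial* is `𝓜 = M₀ + x₁M₁ + ⋯ + xₙMₙ` with
complex hermitian `Mᵢ` (the *symmetric* case: real symmetric `Mᵢ`), always **monic**, `M₀ = I`;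
`p = det 𝓜` is then a real zero polynomial with `p(0) = 1`, and along a line `x = t a` one has
`p_a(t) := p(t a) = det (I + t (a₁M₁ + ⋯ + aₙMₙ))`.  This is *exactly* the tree's normalisation:
`monicPencilDet A = det (I + ∑ xᵢAᵢ)` (real symmetric `Aᵢ`), `lineDet W = det (I + tW)`,
`linePoly p 0 a = p_a` (`linePoly_monicPencilDet_zero`), `IsRZPoly` = real zero with respect to
the origin — all from `MonicPencilRealZero.lean`, reused and not restated.

## What is typed (real symmetric case first, in the tree's vocabulary `monicPencilDet`; the
paper states §2 for hermitian pencils and, where it says so, "symmetric/hermitian" — the hermitian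
forms of Prop. 2.1, Cor. 2.3 and Thm. 2.4 are typed in the last section with the pencil determinant
spelled `det (1 + ∑ X i • (M i).map C) ∈ ℂ[x]`; Rem. 2.2 (ii), Prop. 2.6 and Thm. 2.7 keep a
`TODO(hermitian form)`)

| Source item | Lean | Status |
|---|---|---|
| Prop. 2.1 (non-zero eigenvalues of `∑ aᵢMᵢ` ↔ zeros of `p_a`, `λ ↦ −1/λ`, with multiplicity) | `roots_lineDet_eq`, `prop_2_1` (root multiset = image of the non-zero characteristic roots), `isRoot_lineDet_iff_charpoly`, `natDegree_lineDet_eq_card` | proved |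
| Rem. 2.2 (i) (`p` is a real zero polynomial) | real symmetric: the tree's `MonicPencilRealZero.isRZPoly_monicPencilDet` (cited, not restated); hermitian: `rem_2_2_i_hermitian` (`det (I + ∑ xᵢMᵢ) ∈ ℂ[x]` comes from a real RZ polynomial `q` with `q(0) = 1`) | proved |
| Rem. 2.2 (ii) (`𝓜(a) ⪰ 0` iff `p_a` has no zero in `[0,1)`, i.e. `S(𝓜) = S(p)`) | `posSemidef_one_add_iff_eigenvalues`, `rem_2_2_ii` | proved |
| Cor. 2.3 (every matrix of `span{Mᵢ}` has rank `≤ deg p`; generic rank `= deg p`) | `rank_eq_natDegree_lineDet`, `rank_sum_smul_eq_natDegree` (rank `= deg p_a`, the sentence of the proof), `cor_2_3`, `rank_le_totalDegree`, `rank_sum_smul_eq_totalDegree` + `exists_rank_sum_smul_eq_totalDegree` (generic clause: rank `= deg p` off the zero set of the top form of `p`, which is a non-zero polynomial) | proved |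
| Thm. 2.4 (an RZ polynomial of degree `d` in `n` variables with a symmetric/hermitian monic representation has one of size `n d`) | `thm_2_4`, `thm_2_4_pencil`, `exists_mul_transpose_mul_eq`, `monicPencilDet_conj` | proved (real symmetric) |
| Rem. 2.5 (large representations are trivial extensions of small ones) | content of `thm_2_4_pencil` / `monicPencilDet_conj`: the size-`nd` pencil is a corner `I + ∑ xᵢQᵀMᵢQ` with `MᵢQQᵀ = Mᵢ` | proved |
| Lemma 2.10 (no full line in `S(𝓜)` ⇒ `M₁, …, Mₙ` linearly independent) | `lemma_2_10` (no symmetry hypothesis needed) | proved |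
| Rem. 2.12 (then `n ≤ C(k+1, 2)`) | `rem_2_12` | proved (real symmetric) |
| Example 2.16 (`1 − ∑ xᵢ²` is the determinant of the arrow pencil of size `n + 1`) | `example_2_16`, `example_2_16_isSymm`, `isRZPoly_one_sub_sum_sq` | proved (the example's lower bound via Thm. 2.11 is not typed) |
| Prop. 2.6 (a subspace of symmetric matrices of rank `≤ d` containing a PSD matrix of rank `d` is `{A ⊕ 0}` in an orthonormal basis) | `prop_2_6` (kernel form: `ker W ⊆ ker G` for `W ⪰ 0`, `rank (G + μW) ≤ rank W` for all `μ`) | proved (real symmetric) |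
| Thm. 2.7 (a full-dimensional cone in `S(𝓜)` ⇒ a representation of size `d = deg p`; generalises Brändén's Thm. 2.2) | `thm_2_7`, `thm_2_7_pencil` (from a PSD `∑ aᵢMᵢ` of rank `d`), `exists_posSemidef_rank_eq` (the cone supplies such an `a`) | proved (real symmetric) |
| Lemma 2.13 (`M = R + iS` hermitian ⇒ `M̃ = [[R, S], [−S, R]]` real symmetric with the eigenvalues of `M` doubled) | `lemma_2_13` (`χ_{M̃} = χ_M²`), `lemma_2_13_isSymm`, `transpose_map_re_of_isHermitian` | proved |
| Lemma 2.14 (`det 𝓜̃ = (det 𝓜)²` for the doubled pencil; "a spectrahedron can always be defined by a symmetric pencil") | `lemma_2_14` (in `ℂ[x]`: the real `monicPencilDet` of the doubled pencil, mapped to `ℂ`, is the square of the complex pencil determinant), `lemma_2_14_matrix` (pointwise) | proved |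
| §1 / Rem. 2.2 ("each spectrahedron is `S(p)` for an RZ polynomial `p`") | `spectrahedron_eq_rigidlyConvexSet` | proved (real symmetric) |
| Example 2.16, hermitian `2 × 2` representation of `p₃ = 1 − x₁² − x₂² − x₃²` | `example_2_16_hermitian`, `example_2_16_hermitian_isHermitian` | proved |
| Prop. 2.1 / Cor. 2.3 / Thm. 2.4 for **hermitian** pencils `I + ∑ xᵢMᵢ`, `Mᵢ ∈ H_k(ℂ)` (the printed setting) | `prop_2_1_hermitian`, `roots_lineDet_eq_of_isHermitian`, `lineDet_eq_prod_of_isHermitian`, `rank_eq_natDegree_lineDet_of_isHermitian`, `cor_2_3_hermitian`, `rank_le_totalDegree_hermitian`, `thm_2_4_hermitian`, `thm_2_4_hermitian_pencil`, `exists_mul_conjTranspose_mul_eq`, `det_pencil_conj_hermitian` (pencil determinant written `det (1 + ∑ X i • (M i).map C) ∈ ℂ[x]`, lines `x = t a` with `a` real) | proved |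

Not typed here: Thm. 2.9 (Meshulam's bound on spaces of symmetric matrices of bounded rank — an
external theorem, it would be a named fact), Thms. 2.11 / 2.15 (lower bounds resting on 2.9),
§§3–5, and the hermitian halves of 2.2 (ii) / 2.6 / 2.7 (`TODO(hermitian form)`; Lemmas
2.13–2.14 are the printed bridge: a hermitian pencil's doubling is a symmetric pencil with squared
determinant, hence the same spectrahedron).  The
spectrahedron `S(𝓜) = {a : 𝓜(a) ⪰ 0}`, "contains a full line" and "contains a full-dimensional
cone" are spelled out inline (`(1 + ∑ aᵢAᵢ).PosSemidef`; `∃ a c, c ≠ 0 ∧ ∀ t, 𝓜(a + t c) ⪰ 0`; a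
nonempty open set of directions `a` with `𝓜(t a) ⪰ 0` for all `t ≥ 0`); no new definitions.

## Proof notes (deviations from print)

* Prop. 2.1: the paper computes `c_a(λ) = (−λ)^k p_a(−1/λ)` for the characteristic polynomial;
  for real symmetric `W` we read both sides off the spectral factorisation
  `det (I + tW) = ∏ (λᵢ t + 1)` (`lineDet_eq_prod`) and `c_W = ∏ (t − λᵢ)`
  (`Matrix.IsHermitian.roots_charpoly_eq_eigenvalues`).  Same statement, multiplicities included.
* Thm. 2.4: the paper splits off the common kernel `K₁ ∩ ⋯ ∩ Kₙ` (`dim ≥ k − nd` by "an easy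
  induction with the dimension formula") by an orthogonal base change.  We diagonalise the real
  symmetric matrix `S = ∑ Mᵢ²` orthogonally instead (`Matrix.IsHermitian.eigenvectorUnitary`): its
  eigenvectors with eigenvalue `0` lie in every `ker Mᵢ` (`uᵀSu = ∑ ‖Mᵢu‖²`), and the number of
  the others is `rank S ≤ ∑ rank Mᵢ ≤ n d` (Cor. 2.3 for each `Mᵢ`) — the dual form of the same
  count, `(⋂ ker Mᵢ)^⊥ = range S`.  Those columns, followed by a coordinate embedding into `ℝⁿᵈ`,
  form a `k × nd` matrix `Q` with `MᵢQQᵀ = Mᵢ`, and Sylvester's identity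
  `det (I + AB) = det (I + BA)` (`Matrix.det_one_add_mul_comm`) gives
  `det (I + ∑ xᵢQᵀMᵢQ) = det (I + ∑ xᵢMᵢ)` (`monicPencilDet_conj`), which performs the
  compression, the zero padding when `k < nd`, and the re-indexing in one step.
* Prop. 2.6 / Thm. 2.7: as printed — the `(d+1) × (d+1)` compressions `[[A + λP, b], [bᵀ, c]]`
  of `A' + λP'` are singular for every `λ`, and a Schur complement gives
  `c = bᵀ(A + λP)⁻¹b` — except that the printed limit `λ → ∞` ("the norm of `v` must be
  arbitrarily small") is replaced by evaluating at one `λ` with `A + λP ≻ 0` (`c ≥ 0`) and one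
  with `A + λP ≺ 0` (`c ≤ 0`), whence `c = 0` and then `b = 0`; the off-diagonal entries of the
  printed `C` are handled by polarisation over `ker P'`.  The cone hypothesis of Thm. 2.7 is used
  exactly as in the printed proof: a ray in `S(𝓜)` gives `∑ aᵢMᵢ ⪰ 0`, and the generic rank `d`
  (Cor. 2.3) is attained on any nonempty open set of directions (`MvPolynomial.funext_set` on a
  box inside it).

## Neighbours on this shelf (the dictionary "symmetric determinantal representations")

Without monicity every polynomial has a symmetric determinantal representation:
`Literature.Computability.AlgebraicComplexity.Quarez2012.quarez2012_thm_4_1` (Quarez 2012, size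
`2·C(n+⌊d/2⌋, n)` over rings in which `2` is a unit) and
`Literature.Computability.AlgebraicComplexity.GKKP2011_thm7` (Grenet–Kaltofen–Koiran–Portier 2011,
size polynomial in the formula size, char `≠ 2`); with monicity (`M₀ = I ≻ 0`) representations are
rare (only RZ polynomials qualify, Rem. 2.2 (i); for `n = 2` all of them do —
`Literature.AlgebraicGeometry.DeterminantalHypersurfaces.LewisParriloRamana2005_laxConjecture`)
and, by Thm. 2.4, never need size `> n d`.  Nothing here bears on lower bounds for the permanent.
-/

noncomputable section

open Polynomial Matrix Finset
open Literature.AlgebraicGeometry.HyperbolicPolynomials (linePoly eval_linePoly)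
open Literature.AlgebraicGeometry.DeterminantalHypersurfaces.MonicPencilRealZero

namespace Literature.AlgebraicGeometry.DeterminantalHypersurfaces.NetzerThom2012

/-! ## Preliminaries -/

section Prelim

/-- A real linear combination of symmetric matrices is symmetric. [folklore] -/
private theorem isSymm_sum_smul {ι : Type*} [Fintype ι] {n : Type*} (A : ι → Matrix n n ℝ) (hA : ∀ i, (A i).IsSymm) (a : ι → ℝ) :
    (∑ i, a i • A i).IsSymm := by
  unfold Matrix.IsSymm
  rw [transpose_sum]
  exact Finset.sum_congr rfl fun i _ => by rw [transpose_smul, (hA i).eq]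

/-- `deg_t f(x + t e) ≤ deg f` for every real polynomial `f` (no homogeneity needed). [folklore] -/
private theorem natDegree_linePoly_le_totalDegree {R : Type*} [CommRing R] {σ : Type*}
    (f : MvPolynomial σ R) (x e : σ → R) : (linePoly f x e).natDegree ≤ f.totalDegree := by
  rw [linePoly, MvPolynomial.aeval_def, MvPolynomial.eval₂_eq]
  simp only [Polynomial.algebraMap_eq]
  refine Polynomial.natDegree_sum_le_of_forall_le _ _ fun m hm => ?_
  refine Polynomial.natDegree_mul_le.trans ?_
  rw [Polynomial.natDegree_C, zero_add]
  refine (Polynomial.natDegree_prod_le _ _).trans ?_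
  refine (Finset.sum_le_sum fun i _ => ?_).trans (MvPolynomial.le_totalDegree hm)
  refine Polynomial.natDegree_pow_le.trans ?_
  simpa using Nat.mul_le_mul_left (m i) (Polynomial.natDegree_linear_le (a := e i) (b := x i))

/-- The linear factor `c t + 1` is never the zero polynomial. [folklore] -/
private theorem C_mul_X_add_one_ne_zero (c : ℝ) : (C c * X + 1 : ℝ[X]) ≠ 0 := fun h => by
  have h1 := congr_arg (Polynomial.eval 0) h
  simp at h1

/-- Degree of the linear factor `c t + 1`. [folklore] -/
private theorem natDegree_C_mul_X_add_one (c : ℝ) :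
    (C c * X + 1 : ℝ[X]).natDegree = if c ≠ 0 then 1 else 0 := by
  split_ifs with h
  · rw [← C_1, Polynomial.natDegree_linear h]
  · rw [not_not] at h
    simp [h]

/-- Roots of the linear factor `c t + 1`. [folklore] -/
private theorem roots_C_mul_X_add_one (c : ℝ) :
    (C c * X + 1 : ℝ[X]).roots = if c ≠ 0 then {-c⁻¹} else 0 := by
  split_ifs with h
  · rw [← C_1, Polynomial.roots_C_mul_X_add_C 1 h, mul_one]
  · rw [not_not] at h
    simp [h]

/-- `bind` of optional singletons is `map` over a `filter`. [folklore] -/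
private theorem bind_ite_singleton {α β : Type*} (s : Multiset α) (p : α → Prop)
    [DecidablePred p] (f : α → β) :
    (s.bind fun a => if p a then ({f a} : Multiset β) else 0) = (s.filter p).map f := by
  induction s using Multiset.induction_on with
  | empty => simp
  | cons a s ih =>
      rw [Multiset.cons_bind, ih, Multiset.filter_cons]
      split_ifs with h <;> simp

end Prelim

/-! ## Proposition 2.1: non-zero eigenvalues of `∑ aᵢMᵢ` versus zeros of `t ↦ p(t a)` -/

section Prop21

variable {ι : Type*} [Fintype ι] {n : Type*} [Fintype n] [DecidableEq n]

/-- The degree of `det (I + tW)`, `W` real symmetric, is the number of non-zero eigenvalues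
of `W` (counted with multiplicity). [cite: NetzerThom2012, Prop. 2.1 and proof of Cor. 2.3] -/
theorem natDegree_lineDet_eq_card (W : Matrix n n ℝ) (hW : W.IsHermitian) :
    (lineDet W).natDegree = Fintype.card {i // hW.eigenvalues i ≠ 0} := by
  classical
  rw [lineDet_eq_prod W hW,
    Polynomial.natDegree_prod _ _ fun i _ => C_mul_X_add_one_ne_zero _]
  simp_rw [natDegree_C_mul_X_add_one]
  rw [Finset.sum_boole, Fintype.card_subtype]
  simp

/-- **Netzer–Thom 2012, Prop. 2.1 (real symmetric case), multiset form.** For a real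
symmetric matrix `W` the roots of `t ↦ det (I + tW)` — counted with multiplicity — are exactly
the numbers `−1/μ`, `μ` running over the non-zero eigenvalues of `W` (the non-zero roots of the
characteristic polynomial) with multiplicity.  Printed for the hermitian pencil
`I + x₁M₁ + ⋯ + xₙMₙ` and `W = a₁M₁ + ⋯ + aₙMₙ` (`prop_2_1` below); the tree's pencils
(`monicPencilDet`) have real symmetric coefficients; hermitian form:
`roots_lineDet_eq_of_isHermitian` below.
[cite: NetzerThom2012, Prop. 2.1] -/
theorem roots_lineDet_eq (W : Matrix n n ℝ) (hW : W.IsSymm) :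
    (lineDet W).roots = (W.charpoly.roots.filter (· ≠ 0)).map fun μ => -μ⁻¹ := by
  classical
  have hH : W.IsHermitian := isHermitian_iff_isSymm.mpr hW
  rw [lineDet_eq_prod W hH, Polynomial.roots_prod _ _
      (Finset.prod_ne_zero_iff.mpr fun i _ => C_mul_X_add_one_ne_zero _),
    hH.roots_charpoly_eq_eigenvalues]
  simp_rw [roots_C_mul_X_add_one]
  rw [bind_ite_singleton, Multiset.filter_map, Multiset.map_map]
  simp [RCLike.ofReal_real_eq_id]

/-- **Netzer–Thom 2012, Prop. 2.1 (real symmetric case).** Let `p = det (I + x₁A₁ + ⋯ + xₘAₘ)`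
with real symmetric `Aᵢ` and `a ∈ ℝᵐ`.  The non-zero eigenvalues of `a₁A₁ + ⋯ + aₘAₘ` are in
one-to-one correspondence, counting multiplicities, with the zeros of the univariate polynomial
`p_a(t) = p(t a)`, via `μ ↦ −1/μ`: the root multiset of `p_a` is the image of the multiset of
non-zero characteristic roots.  (Printed for hermitian `Mᵢ`; typed for the tree's real
symmetric monic pencils `monicPencilDet`, normalised as `I + ∑ xᵢAᵢ` exactly as printed;
hermitian form: `prop_2_1_hermitian` below.)
[cite: NetzerThom2012, Prop. 2.1] -/
theorem prop_2_1 (A : ι → Matrix n n ℝ) (hA : ∀ i, (A i).IsSymm) (a : ι → ℝ) :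
    (linePoly (monicPencilDet A) 0 a).roots =
      ((∑ i, a i • A i).charpoly.roots.filter (· ≠ 0)).map fun μ => -μ⁻¹ := by
  rw [linePoly_monicPencilDet_zero]
  exact roots_lineDet_eq _ (isSymm_sum_smul A hA a)

/-- Prop. 2.1 at the level of individual zeros: `t` is a zero of `det (I + tW)` iff `t ≠ 0` and
`−1/t` is an eigenvalue (characteristic root) of the real symmetric matrix `W`.
[cite: NetzerThom2012, Prop. 2.1] -/
theorem isRoot_lineDet_iff_charpoly (W : Matrix n n ℝ) (hW : W.IsSymm) (t : ℝ) :
    (lineDet W).IsRoot t ↔ t ≠ 0 ∧ W.charpoly.IsRoot (-t⁻¹) := by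
  rw [← Polynomial.mem_roots (lineDet_ne_zero W), roots_lineDet_eq W hW, Multiset.mem_map]
  simp only [Multiset.mem_filter, Polynomial.mem_roots (Matrix.charpoly_monic W).ne_zero]
  constructor
  · rintro ⟨μ, ⟨hμ, hμ0⟩, rfl⟩
    refine ⟨by simpa using hμ0, ?_⟩
    rwa [inv_neg, inv_inv, neg_neg]
  · rintro ⟨ht, h⟩
    exact ⟨-t⁻¹, ⟨h, by simpa using ht⟩, by rw [inv_neg, inv_inv, neg_neg]⟩

end Prop21

/-! ## Remark 2.2 (ii): `𝓜(a) ⪰ 0` iff `p_a` has no zero in `[0, 1)` -/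

section Rem22

variable {ι : Type*} [Fintype ι] {n : Type*} [Fintype n] [DecidableEq n]

/-- `I + W ⪰ 0` iff every eigenvalue of the real symmetric matrix `W` is `≥ −1`.
[cite: NetzerThom2012, Rem. 2.2 (ii) (proof)] -/
theorem posSemidef_one_add_iff_eigenvalues (W : Matrix n n ℝ) (hW : W.IsHermitian) :
    (1 + W).PosSemidef ↔ ∀ i, -1 ≤ hW.eigenvalues i := by
  rw [Matrix.posSemidef_iff_isHermitian_and_spectrum_nonneg]
  have h1 : (1 + W).IsHermitian := Matrix.isHermitian_one.add hW
  have hspec : spectrum ℝ (1 + W) = (fun μ => (1 : ℝ) + μ) '' Set.range hW.eigenvalues := by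
    rw [← hW.spectrum_real_eq_range_eigenvalues, ← Set.singleton_add, spectrum.singleton_add_eq,
      map_one]
  simp only [h1, true_and, hspec, Set.image_subset_iff, Set.range_subset_iff, Set.mem_preimage,
    Set.mem_setOf_eq]
  exact forall_congr' fun i => by constructor <;> intro h <;> linarith

/-- **Netzer–Thom 2012, Remark 2.2 (ii) (real symmetric case): the spectrahedron of a monic
pencil is the rigidly convex set of its determinant, `S(𝓜) = S(p)`.** For real symmetric `Aᵢ`
and `a ∈ ℝᵐ`, the matrix `𝓜(a) = I + a₁A₁ + ⋯ + aₘAₘ` is positive semidefinite iff the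
univariate polynomial `p_a(t) = p(t a)`, `p = det 𝓜`, has no zero in the interval `[0, 1)`
(by Prop. 2.1 the zeros are the `−1/λ`, and `−1/λ ∈ [0,1)` iff `λ < −1`).
TODO(hermitian form). [cite: NetzerThom2012, Rem. 2.2 (ii)] -/
theorem rem_2_2_ii (A : ι → Matrix n n ℝ) (hA : ∀ i, (A i).IsSymm) (a : ι → ℝ) :
    (1 + ∑ i, a i • A i).PosSemidef ↔
      ∀ t : ℝ, 0 ≤ t → t < 1 → ¬ (linePoly (monicPencilDet A) 0 a).IsRoot t := by
  have hH : (∑ i, a i • A i).IsHermitian := isHermitian_iff_isSymm.mpr (isSymm_sum_smul A hA a)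
  rw [posSemidef_one_add_iff_eigenvalues _ hH, linePoly_monicPencilDet_zero]
  simp only [isRoot_lineDet_iff _ hH, not_exists]
  constructor
  · intro h t ht0 ht1 i hi
    have hneg : hH.eigenvalues i < 0 := by nlinarith [h i]
    nlinarith [h i, mul_pos_of_neg_of_neg hneg (sub_neg.mpr ht1)]
  · intro h i
    by_contra hlt
    rw [not_le] at hlt
    have hne : hH.eigenvalues i ≠ 0 := by intro h0; rw [h0] at hlt; linarith
    refine h (-(hH.eigenvalues i)⁻¹) ?_ ?_ i (by rw [mul_neg, mul_inv_cancel₀ hne]; ring)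
    · have : (hH.eigenvalues i)⁻¹ < 0 := inv_lt_zero.mpr (by linarith)
      linarith
    · -- `λ < -1 < 0` gives `-1 < 1/λ`, i.e. `-1/λ < 1`
      have hneg : hH.eigenvalues i < 0 := by linarith
      have hprod : hH.eigenvalues i * (hH.eigenvalues i)⁻¹ = 1 := mul_inv_cancel₀ hne
      nlinarith [hprod]

end Rem22

/-! ## Corollary 2.3: every matrix of the pencil span has rank at most `deg p` -/

section Cor23

variable {ι : Type*} [Fintype ι] {n : Type*} [Fintype n] [DecidableEq n]

/-- The rank of a real symmetric matrix `W` is the degree of `t ↦ det (I + tW)` (both count the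
non-zero eigenvalues with multiplicity). [cite: NetzerThom2012, proof of Cor. 2.3] -/
theorem rank_eq_natDegree_lineDet (W : Matrix n n ℝ) (hW : W.IsSymm) :
    W.rank = (lineDet W).natDegree := by
  have hH : W.IsHermitian := isHermitian_iff_isSymm.mpr hW
  rw [hH.rank_eq_card_non_zero_eigs, natDegree_lineDet_eq_card W hH]

/-- The sentence of the printed proof of Cor. 2.3: the rank of `a₁A₁ + ⋯ + aₘAₘ` is *precisely*
the degree of `p_a(t) = p(t a)`, `p = det (I + ∑ xᵢAᵢ)` (so it equals `deg p` whenever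
`deg p_a = deg p`, which holds for generic `a`, see `rank_sum_smul_eq_totalDegree`).
[cite: NetzerThom2012, Cor. 2.3 (proof)] -/
theorem rank_sum_smul_eq_natDegree (A : ι → Matrix n n ℝ) (hA : ∀ i, (A i).IsSymm)
    (a : ι → ℝ) :
    (∑ i, a i • A i).rank = (linePoly (monicPencilDet A) 0 a).natDegree := by
  rw [linePoly_monicPencilDet_zero]
  exact rank_eq_natDegree_lineDet _ (isSymm_sum_smul A hA a)

/-- **Netzer–Thom 2012, Cor. 2.3 (real symmetric case).** If `p = det (I + x₁A₁ + ⋯ + xₘAₘ)`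
with real symmetric `Aᵢ`, then every matrix of the real span of `A₁, …, Aₘ` has rank at most
`deg p`.  (Printed for hermitian pencils: `cor_2_3_hermitian` below.)
[cite: NetzerThom2012, Cor. 2.3] -/
theorem cor_2_3 (A : ι → Matrix n n ℝ) (hA : ∀ i, (A i).IsSymm) (a : ι → ℝ) :
    (∑ i, a i • A i).rank ≤ (monicPencilDet A).totalDegree := by
  rw [rank_sum_smul_eq_natDegree A hA a]
  exact natDegree_linePoly_le_totalDegree _ _ _

/-- Cor. 2.3 for the coefficient matrices themselves: `rank Aᵢ ≤ deg p`.
[cite: NetzerThom2012, Cor. 2.3] -/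
theorem rank_le_totalDegree (A : ι → Matrix n n ℝ) (hA : ∀ i, (A i).IsSymm) (i : ι) :
    (A i).rank ≤ (monicPencilDet A).totalDegree := by
  classical
  have h := cor_2_3 A hA (Pi.single i 1)
  rwa [Fintype.sum_eq_single i (fun j hj => by rw [Pi.single_eq_of_ne hj, zero_smul]),
    Pi.single_eq_same, one_smul] at h

/-- `linePoly` is additive over finite sums. [folklore] -/
private theorem linePoly_sum {σ κ : Type*} (s : Finset κ) (f : κ → MvPolynomial σ ℝ)
    (x e : σ → ℝ) : linePoly (∑ j ∈ s, f j) x e = ∑ j ∈ s, linePoly (f j) x e := by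
  unfold linePoly
  exact map_sum _ _ _

/-- The coefficient of `t^{deg p}` in `p_a(t) = p(t a)` is the top homogeneous component of `p`
evaluated at `a`. [cite: NetzerThom2012, Cor. 2.3 (proof: "for all `a` for which `p_a` has
degree precisely `d`")] -/
theorem coeff_linePoly_zero_totalDegree {σ : Type*} (p : MvPolynomial σ ℝ) (a : σ → ℝ) :
    (linePoly p 0 a).coeff p.totalDegree =
      MvPolynomial.eval a (MvPolynomial.homogeneousComponent p.totalDegree p) := by
  classical
  have key : linePoly p 0 a = ∑ j ∈ Finset.range (p.totalDegree + 1),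
      linePoly (MvPolynomial.homogeneousComponent j p) 0 a := by
    conv_lhs => rw [← MvPolynomial.sum_homogeneousComponent p]
    rw [linePoly_sum]
  rw [key, Polynomial.finsetSum_coeff, Finset.sum_range_succ,
    Finset.sum_eq_zero fun j hj => ?_, zero_add]
  · exact Literature.AlgebraicGeometry.HyperbolicPolynomials.coeff_linePoly_eq_eval
      (MvPolynomial.homogeneousComponent_isHomogeneous _ p) 0 a
  · exact Polynomial.coeff_eq_zero_of_natDegree_lt
      ((Literature.AlgebraicGeometry.HyperbolicPolynomials.natDegree_linePoly_le
        (MvPolynomial.homogeneousComponent_isHomogeneous j p) 0 a).trans_lt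
          (Finset.mem_range.mp hj))

/-- **Cor. 2.3, generic clause (real symmetric case).** If the top-degree form of
`p = det (I + ∑ xᵢAᵢ)` does not vanish at `a` (a Zariski-open condition, non-vacuous by
`exists_rank_sum_smul_eq_totalDegree`), then `a₁A₁ + ⋯ + aₘAₘ` has rank *precisely* `deg p`.
[cite: NetzerThom2012, Cor. 2.3] -/
theorem rank_sum_smul_eq_totalDegree (A : ι → Matrix n n ℝ) (hA : ∀ i, (A i).IsSymm)
    {a : ι → ℝ} (ha : MvPolynomial.eval a (MvPolynomial.homogeneousComponent
      (monicPencilDet A).totalDegree (monicPencilDet A)) ≠ 0) :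
    (∑ i, a i • A i).rank = (monicPencilDet A).totalDegree := by
  rw [rank_sum_smul_eq_natDegree A hA a]
  refine le_antisymm (natDegree_linePoly_le_totalDegree _ _ _) ?_
  exact Polynomial.le_natDegree_of_ne_zero (by rwa [coeff_linePoly_zero_totalDegree])

/-- The top homogeneous component of a non-zero polynomial is non-zero. [folklore] -/
private theorem homogeneousComponent_totalDegree_ne_zero {σ : Type*} {p : MvPolynomial σ ℝ}
    (hp : p ≠ 0) :
    MvPolynomial.homogeneousComponent p.totalDegree p ≠ 0 := by
  classical
  have hne : p.support.Nonempty := MvPolynomial.support_nonempty.mpr hp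
  obtain ⟨s, hs, hsup⟩ := Finset.exists_mem_eq_sup p.support hne (fun s => s.sum fun _ e => e)
  intro h0
  have hc := congr_arg (MvPolynomial.coeff s) h0
  rw [MvPolynomial.coeff_homogeneousComponent, if_pos, MvPolynomial.coeff_zero] at hc
  · exact (MvPolynomial.mem_support_iff.mp hs) hc
  · rw [MvPolynomial.totalDegree, hsup]
    rfl

/-- **Cor. 2.3, "the generic linear combination has rank precisely `d`"** (real symmetric
case): some — indeed Zariski-generically every — `a₁A₁ + ⋯ + aₘAₘ` has rank exactly `deg p`.
[cite: NetzerThom2012, Cor. 2.3] -/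
theorem exists_rank_sum_smul_eq_totalDegree (A : ι → Matrix n n ℝ) (hA : ∀ i, (A i).IsSymm) :
    ∃ a : ι → ℝ, (∑ i, a i • A i).rank = (monicPencilDet A).totalDegree := by
  have hp : monicPencilDet A ≠ 0 := fun h => by
    have h1 := eval_zero_monicPencilDet A
    rw [h, map_zero] at h1
    exact zero_ne_one h1
  have hq := homogeneousComponent_totalDegree_ne_zero hp
  by_contra hall
  rw [not_exists] at hall
  refine hq (MvPolynomial.funext fun a => ?_)
  rw [map_zero]
  by_contra ha
  exact hall a (rank_sum_smul_eq_totalDegree A hA ha)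

end Cor23

/-! ## Theorem 2.4: compression to size `n·d` -/

section Thm24

variable {ι : Type*} [Fintype ι] {k : Type*} [Fintype k] [DecidableEq k]

/-- **Corner compression / trivial extension.** If `Q` is a `k × m` real matrix with
`Mᵢ Q Qᵀ = Mᵢ` for all `i` (e.g. the columns of `Q` are an orthonormal basis of a subspace
containing all the column spaces of the `Mᵢ`, or `Q` is a coordinate embedding), then the corner
pencil `I + ∑ xᵢ QᵀMᵢQ` has the same determinant as `I + ∑ xᵢMᵢ` (Sylvester's
`det (I + AB) = det (I + BA)`).  This is the mechanism of the proof of Thm. 2.4 and of Remark 2.5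
("larger representations only arise as trivial extensions of small ones").
[cite: NetzerThom2012, proof of Thm. 2.4 and Rem. 2.5] -/
theorem monicPencilDet_conj {m : Type*} [Fintype m] [DecidableEq m]
    (M : ι → Matrix k k ℝ) (Q : Matrix k m ℝ) (hQ : ∀ i, M i * (Q * Qᵀ) = M i) :
    monicPencilDet (fun i => Qᵀ * M i * Q) = monicPencilDet M := by
  unfold monicPencilDet
  set Qc : Matrix k m (MvPolynomial ι ℝ) := Q.map MvPolynomial.C with hQc
  set S : Matrix k k (MvPolynomial ι ℝ) :=
    ∑ i, (MvPolynomial.X i : MvPolynomial ι ℝ) • (M i).map MvPolynomial.C with hS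
  have h1 : ∑ i, (MvPolynomial.X i : MvPolynomial ι ℝ) • (Qᵀ * M i * Q).map MvPolynomial.C
      = Qcᵀ * (S * Qc) := by
    rw [hS, Matrix.sum_mul, Matrix.mul_sum]
    refine Finset.sum_congr rfl fun i _ => ?_
    rw [Matrix.map_mul, Matrix.map_mul, Matrix.transpose_map, ← hQc]
    simp only [Matrix.smul_mul, Matrix.mul_smul, Matrix.mul_assoc]
  have h2 : S * (Qc * Qcᵀ) = S := by
    rw [hS, Matrix.sum_mul]
    refine Finset.sum_congr rfl fun i _ => ?_
    rw [Matrix.smul_mul, hQc, ← Matrix.transpose_map, ← Matrix.map_mul, ← Matrix.map_mul, hQ i]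
  rw [h1, Matrix.det_one_add_mul_comm, Matrix.mul_assoc, h2]

/-- Subadditivity of the rank of real matrices. [folklore] -/
private theorem rank_add_le {K : Type*} [Field K] {m l : Type*} [Fintype m] [Fintype l]
    (A B : Matrix m l K) :
    (A + B).rank ≤ A.rank + B.rank := by
  unfold Matrix.rank
  rw [Matrix.mulVecLin_add]
  exact (Submodule.finrank_mono (LinearMap.range_add_le _ _)).trans
    (Submodule.finrank_add_le_finrank_add_finrank _ _)

/-- Subadditivity of the rank over a finite sum. [folklore] -/
private theorem rank_sum_le {K : Type*} [Field K] {κ m l : Type*} [Fintype m] [Fintype l]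
    (s : Finset κ) (A : κ → Matrix m l K) :
    (∑ i ∈ s, A i).rank ≤ ∑ i ∈ s, (A i).rank := by
  classical
  induction s using Finset.induction_on with
  | empty => simp
  | insert i s hi ih =>
      rw [Finset.sum_insert hi, Finset.sum_insert hi]
      exact (rank_add_le _ _).trans (Nat.add_le_add_left ih _)

/-- A vector killed by `∑ᵢ Mᵢ²` (symmetric `Mᵢ`) is killed by every `Mᵢ`, since
`uᵀ (∑ Mᵢ²) u = ∑ ‖Mᵢu‖²`. [folklore] -/
private theorem mulVec_eq_zero_of_sum_mul_self {l : Type*} [Fintype l] (M : ι → Matrix l l ℝ)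
    (hM : ∀ i, (M i).IsSymm)
    (u : l → ℝ) (hu : (∑ i, M i * M i) *ᵥ u = 0) (i : ι) : M i *ᵥ u = 0 := by
  have key : ∀ j, u ⬝ᵥ ((M j * M j) *ᵥ u) = (M j *ᵥ u) ⬝ᵥ (M j *ᵥ u) := fun j => by
    rw [← mulVec_mulVec, dotProduct_mulVec, ← mulVec_transpose, (hM j).eq]
  have h0 : ∑ j, (M j *ᵥ u) ⬝ᵥ (M j *ᵥ u) = 0 := by
    have h := congr_arg (fun v => u ⬝ᵥ v) hu
    simpa only [Matrix.sum_mulVec, dotProduct_sum, key, dotProduct_zero] using h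
  have hnn : ∀ j ∈ (univ : Finset ι), 0 ≤ (M j *ᵥ u) ⬝ᵥ (M j *ᵥ u) := fun j _ =>
    Finset.sum_nonneg fun x _ => mul_self_nonneg _
  exact dotProduct_self_eq_zero.mp ((Finset.sum_eq_zero_iff_of_nonneg hnn).mp h0 i (mem_univ i))

/-- **Compression lemma (proof of Thm. 2.4, real symmetric case).** For real symmetric
`M₁, …, Mₘ` of size `k` and any `N ≥ ∑ rank Mᵢ` there is a `k × N` real matrix `Q` with
`Mᵢ Q Qᵀ = Mᵢ` for all `i`; hence (`monicPencilDet_conj`) the `N × N` symmetric corner pencil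
`I + ∑ xᵢ QᵀMᵢQ` has the same determinant.  Construction: diagonalise `S = ∑ Mᵢ²` orthogonally;
the eigenvectors with eigenvalue `0` lie in `⋂ ker Mᵢ`, the remaining `rank S ≤ ∑ rank Mᵢ`
eigenvector columns form `Q` (padded by a coordinate embedding into `ℝᴺ`).  The printed proof
splits off the common kernel `K₁ ∩ ⋯ ∩ Kₙ`, `dim ≥ k − nd`, by an orthogonal base change; we use
the complementary count through `S` (same subspace `(⋂ ker Mᵢ)^⊥ = ∑ range Mᵢ`).
[cite: NetzerThom2012, proof of Thm. 2.4] -/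
theorem exists_mul_transpose_mul_eq (M : ι → Matrix k k ℝ) (hM : ∀ i, (M i).IsSymm) {N : ℕ}
    (hN : ∑ i, (M i).rank ≤ N) :
    ∃ Q : Matrix k (Fin N) ℝ, ∀ i, M i * (Q * Qᵀ) = M i := by
  classical
  set S : Matrix k k ℝ := ∑ i, M i * M i with hSdef
  have hS : S.IsHermitian := by
    refine isHermitian_iff_isSymm.mpr ?_
    unfold Matrix.IsSymm
    rw [hSdef, transpose_sum]
    exact Finset.sum_congr rfl fun i _ => by rw [transpose_mul, (hM i).eq]
  set U : Matrix k k ℝ := (hS.eigenvectorUnitary : Matrix k k ℝ) with hU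
  have hUU : U * Uᵀ = 1 := by
    have h := Matrix.mem_unitaryGroup_iff.mp (hS.eigenvectorUnitary).2
    rwa [star_eq_conjTranspose, conjTranspose_eq_transpose_of_trivial] at h
  -- eigenvectors of `S` with eigenvalue `0` are common kernel vectors
  have hker : ∀ j, hS.eigenvalues j = 0 → ∀ i, M i *ᵥ (Uᵀ j) = 0 := by
    intro j hj i
    have h1 : S *ᵥ (Uᵀ j) = 0 := by
      rw [hU, Matrix.IsHermitian.eigenvectorUnitary_transpose_apply, hS.mulVec_eigenvectorBasis j,
        hj, zero_smul]
    rw [hSdef] at h1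
    exact mulVec_eq_zero_of_sum_mul_self M hM _ h1 i
  -- the columns of `U` with non-zero eigenvalue
  have hcard : Fintype.card {j : k // hS.eigenvalues j ≠ 0} ≤ Fintype.card (Fin N) := by
    rw [Fintype.card_fin, ← hS.rank_eq_card_non_zero_eigs]
    calc S.rank ≤ ∑ i, (M i * M i).rank := rank_sum_le _ _
      _ ≤ ∑ i, (M i).rank := Finset.sum_le_sum fun i _ => Matrix.rank_mul_le_left _ _
      _ ≤ N := hN
  obtain ⟨f⟩ := Function.Embedding.nonempty_of_card_le hcard
  let Q₁ : Matrix k {j : k // hS.eigenvalues j ≠ 0} ℝ := fun a j => U a j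
  let Q₀ : Matrix k {j : k // ¬ hS.eigenvalues j ≠ 0} ℝ := fun a j => U a j
  let Q₂ : Matrix {j : k // hS.eigenvalues j ≠ 0} (Fin N) ℝ := fun j b => if f j = b then 1 else 0
  have hsplit : U * Uᵀ = Q₁ * Q₁ᵀ + Q₀ * Q₀ᵀ := by
    ext a b
    simp only [Matrix.mul_apply, Matrix.add_apply, Matrix.transpose_apply, Q₁, Q₀]
    exact (Fintype.sum_subtype_add_sum_subtype (fun j => hS.eigenvalues j ≠ 0)
      (fun j => U a j * U b j)).symm
  have hQ₀ : ∀ i, M i * Q₀ = 0 := fun i => by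
    ext a j
    have h := congr_fun (hker j.1 (not_not.mp j.2) i) a
    simpa [Q₀, Matrix.mul_apply, Matrix.mulVec, dotProduct] using h
  have hQ₁ : ∀ i, M i * (Q₁ * Q₁ᵀ) = M i := fun i => by
    have h : M i * (U * Uᵀ) = M i * (Q₁ * Q₁ᵀ) + M i * Q₀ * Q₀ᵀ := by
      rw [hsplit, Matrix.mul_add, Matrix.mul_assoc]
    rw [hUU, Matrix.mul_one, hQ₀ i, Matrix.zero_mul, add_zero] at h
    exact h.symm
  have hQ₂ : Q₂ * Q₂ᵀ = 1 := by
    ext j j'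
    simp [Q₂, Matrix.mul_apply, Matrix.one_apply, f.injective.eq_iff, eq_comm]
  refine ⟨Q₁ * Q₂, fun i => ?_⟩
  have hassoc : Q₁ * Q₂ * (Q₁ * Q₂)ᵀ = Q₁ * (Q₂ * Q₂ᵀ) * Q₁ᵀ := by
    rw [transpose_mul]
    simp only [Matrix.mul_assoc]
  rw [hassoc, hQ₂, Matrix.mul_one, hQ₁ i]

/-- The corner `QᵀMQ` of a symmetric matrix is symmetric. [folklore] -/
private theorem isSymm_conj {l m : Type*} [Fintype l] (W : Matrix l l ℝ) (hW : W.IsSymm)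
    (Q : Matrix l m ℝ) : (Qᵀ * W * Q).IsSymm := by
  unfold Matrix.IsSymm
  rw [transpose_mul, transpose_mul, transpose_transpose, hW.eq, Matrix.mul_assoc]

/-- **Netzer–Thom 2012, Thm. 2.4 (real symmetric case), pencil form.** A real symmetric monic
pencil `I + x₁M₁ + ⋯ + xₙMₙ` of any size whose determinant `p` has degree `≤ d` can be replaced
by a real symmetric monic pencil of size exactly `n·d` with the same determinant; the new pencil
is a corner `I + ∑ xᵢ QᵀMᵢQ` with `Mᵢ Q Qᵀ = Mᵢ` (Remark 2.5: every representation is a trivial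
extension of a small one).  Printed "symmetric/hermitian"; typed for the real symmetric pencils
of the tree (`monicPencilDet`, normalised `I + ∑ xᵢMᵢ` as printed); hermitian form:
`thm_2_4_hermitian_pencil` below.
[cite: NetzerThom2012, Thm. 2.4 and Rem. 2.5] -/
theorem thm_2_4_pencil (M : ι → Matrix k k ℝ) (hM : ∀ i, (M i).IsSymm) {d : ℕ}
    (hd : (monicPencilDet M).totalDegree ≤ d) :
    ∃ Q : Matrix k (Fin (Fintype.card ι * d)) ℝ,
      (∀ i, M i * (Q * Qᵀ) = M i) ∧ (∀ i, (Qᵀ * M i * Q).IsSymm) ∧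
        monicPencilDet (fun i => Qᵀ * M i * Q) = monicPencilDet M := by
  have hN : ∑ i, (M i).rank ≤ Fintype.card ι * d :=
    calc ∑ i, (M i).rank ≤ ∑ _i : ι, d :=
          Finset.sum_le_sum fun i _ => (rank_le_totalDegree M hM i).trans hd
      _ = Fintype.card ι * d := by rw [Finset.sum_const, smul_eq_mul, Finset.card_univ]
  obtain ⟨Q, hQ⟩ := exists_mul_transpose_mul_eq M hM hN
  exact ⟨Q, hQ, fun i => isSymm_conj _ (hM i) Q, monicPencilDet_conj M Q hQ⟩

/-- **Netzer–Thom 2012, Thm. 2.4 (real symmetric case).** Let `p ∈ ℝ[x₁, …, xₙ]` be (an RZ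
polynomial) of degree `d`.  If `p` has a (monic) symmetric determinantal representation
`p = det (I + x₁M₁ + ⋯ + xₙMₙ)`, `Mᵢ` real symmetric of some size `k`, then it has one of size
`n·d`.  The RZ hypothesis of the printed statement is automatic for such `p`
(`isRZPoly_monicPencilDet`) and therefore not repeated; "degree `d`" is relaxed to
`deg p ≤ d`.  Printed "symmetric/hermitian": the hermitian half is `thm_2_4_hermitian` below.
[cite: NetzerThom2012, Thm. 2.4] -/
theorem thm_2_4 (p : MvPolynomial ι ℝ) {d : ℕ} (hd : p.totalDegree ≤ d)
    (M : ι → Matrix k k ℝ) (hM : ∀ i, (M i).IsSymm) (hp : monicPencilDet M = p) :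
    ∃ M' : ι → Matrix (Fin (Fintype.card ι * d)) (Fin (Fintype.card ι * d)) ℝ,
      (∀ i, (M' i).IsSymm) ∧ monicPencilDet M' = p := by
  subst hp
  obtain ⟨Q, -, hsymm, hdet⟩ := thm_2_4_pencil M hM hd
  exact ⟨fun i => Qᵀ * M i * Q, hsymm, hdet⟩

end Thm24

/-! ## Lemma 2.10 and Remark 2.12: no full line in `S(𝓜)` -/

section Lemma210

variable {ι : Type*} [Fintype ι] {n : Type*} [Fintype n] [DecidableEq n]

omit [Fintype n] in
/-- **Netzer–Thom 2012, Lemma 2.10.** Let `𝓜 = I + x₁A₁ + ⋯ + xₘAₘ` be a (monic) linear matrix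
polynomial.  If the spectrahedron `S(𝓜) = {a ∈ ℝᵐ : 𝓜(a) ⪰ 0}` does not contain a full line
`{a + t c : t ∈ ℝ}` (`c ≠ 0`), then `A₁, …, Aₘ` are `ℝ`-linearly independent.  (Printed for
hermitian pencils; the statement and proof need no symmetry at all: a dependency `∑ cᵢAᵢ = 0`
puts the whole line `ℝ c` through the origin inside `S(𝓜)`.) [cite: NetzerThom2012, Lemma 2.10] -/
theorem lemma_2_10 (A : ι → Matrix n n ℝ)
    (h : ¬ ∃ a c : ι → ℝ, c ≠ 0 ∧ ∀ t : ℝ, (1 + ∑ i, (a + t • c) i • A i).PosSemidef) :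
    LinearIndependent ℝ A := by
  by_contra hli
  obtain ⟨g, hg, i, hi⟩ := Fintype.not_linearIndependent_iff.mp hli
  refine h ⟨0, g, fun h0 => hi (by rw [h0, Pi.zero_apply]), fun t => ?_⟩
  have h0 : ∑ j, (0 + t • g) j • A j = 0 := by
    simp only [zero_add, Pi.smul_apply, smul_eq_mul, mul_smul, ← Finset.smul_sum, hg, smul_zero]
  rw [h0, add_zero]
  exact Matrix.PosSemidef.one

/-- **Netzer–Thom 2012, Remark 2.12 (real symmetric case).** In the setting of Thm. 2.11 — a
symmetric pencil of size `k` in `m` variables whose spectrahedron contains no full line —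
Lemma 2.10 gives `m ≤ C(k+1, 2) = dim Sym_k(ℝ)`. [cite: NetzerThom2012, Rem. 2.12] -/
theorem rem_2_12 (A : ι → Matrix n n ℝ) (hA : ∀ i, (A i).IsSymm)
    (h : ¬ ∃ a c : ι → ℝ, c ≠ 0 ∧ ∀ t : ℝ, (1 + ∑ i, (a + t • c) i • A i).PosSemidef) :
    Fintype.card ι ≤ (Fintype.card n + 1).choose 2 := by
  classical
  have hli := lemma_2_10 A h
  -- the linear map "upper triangle" `B ↦ (B i j + B j i)_{ {i,j} }`, injective on symmetric `B`
  let Φ : Matrix n n ℝ →ₗ[ℝ] (Sym2 n → ℝ) :=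
    { toFun := fun B s => Sym2.lift ⟨fun i j => B i j + B j i, fun i j => add_comm _ _⟩ s
      map_add' := fun B B' => by
        funext s
        induction s using Sym2.ind with
        | h i j => simp only [Sym2.lift_mk, Matrix.add_apply, Pi.add_apply]; ring
      map_smul' := fun c B => by
        funext s
        induction s using Sym2.ind with
        | h i j => simp only [Sym2.lift_mk, Matrix.smul_apply, Pi.smul_apply, smul_eq_mul,
            RingHom.id_apply]; ring }
  have hΦ : LinearIndependent ℝ (fun i => Φ (A i)) := by
    rw [Fintype.linearIndependent_iff]
    intro g hg
    have hsum : Φ (∑ i, g i • A i) = 0 := by rw [map_sum]; simpa only [map_smul] using hg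
    have hzero : ∑ i, g i • A i = 0 := by
      ext a b
      have hab := congr_fun hsum s(a, b)
      have hsym := (isSymm_sum_smul A hA g).apply b a
      simp only [Φ, LinearMap.coe_mk, AddHom.coe_mk, Sym2.lift_mk, Pi.zero_apply] at hab
      rw [hsym] at hab
      rw [Matrix.zero_apply]
      linarith
    exact Fintype.linearIndependent_iff.mp hli g hzero
  calc Fintype.card ι ≤ Module.finrank ℝ (Sym2 n → ℝ) := hΦ.fintype_card_le_finrank
    _ = Fintype.card (Sym2 n) := Module.finrank_fintype_fun_eq_card ℝ
    _ = (Fintype.card n + 1).choose 2 := Sym2.card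

end Lemma210

/-! ## Example 2.16: the ball `1 − x₁² − ⋯ − xₙ² ≥ 0` is a spectrahedron of size `n + 1` -/

section Example216

variable {ι : Type*} [Fintype ι] [DecidableEq ι]

/-- **Netzer–Thom 2012, Example 2.16 (the explicit representation).** The quadratic RZ polynomial
`pₙ = 1 − x₁² − ⋯ − xₙ²` is the determinant of the monic symmetric "arrow" pencil of size `n + 1`
with first row and column `(1, x₁, …, xₙ)` and identity diagonal: coefficient matrices
`E₁ₖ + Eₖ₁` (`k = 1, …, n`, indices `Option ι`, `none` = the corner).  (The example's lower
bound "no symmetric representation of size `< n` for `n > 3`" rests on Thm. 2.11 / Meshulam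
and is not typed.) [cite: NetzerThom2012, Example 2.16] -/
theorem example_2_16 :
    monicPencilDet (fun i : ι =>
        (Matrix.single none (some i) (1 : ℝ) + Matrix.single (some i) none 1 :
          Matrix (Option ι) (Option ι) ℝ)) = 1 - ∑ i, MvPolynomial.X i ^ 2 := by
  unfold monicPencilDet
  set e : Option ι ≃ ι ⊕ Unit := Equiv.optionEquivSumPUnit ι with he
  have key : (1 : Matrix (Option ι) (Option ι) (MvPolynomial ι ℝ)) +
      ∑ i, (MvPolynomial.X i : MvPolynomial ι ℝ) •
        (Matrix.single none (some i) (1 : ℝ) + Matrix.single (some i) none 1 :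
          Matrix (Option ι) (Option ι) ℝ).map MvPolynomial.C
      = (Matrix.fromBlocks (1 : Matrix ι ι (MvPolynomial ι ℝ))
          (Matrix.of fun j (_ : Unit) => MvPolynomial.X j)
          (Matrix.of fun (_ : Unit) j => MvPolynomial.X j) (1 : Matrix Unit Unit _)).submatrix
          e e := by
    ext a b
    rcases a with _ | a <;> rcases b with _ | b
    · simp [he, Matrix.sum_apply, Matrix.single]
    · simp [he, Matrix.sum_apply, Matrix.single]
    · simp [he, Matrix.sum_apply, Matrix.single]
    · simp [he, Matrix.sum_apply, Matrix.single, Matrix.one_apply]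
  rw [key, Matrix.det_submatrix_equiv_self, Matrix.det_fromBlocks_one₁₁, Matrix.det_unique]
  simp [Matrix.mul_apply, sq]

omit [Fintype ι] in
/-- The arrow pencil of Example 2.16 has symmetric coefficient matrices.
[cite: NetzerThom2012, Example 2.16] -/
theorem example_2_16_isSymm (i : ι) :
    (Matrix.single none (some i) (1 : ℝ) + Matrix.single (some i) none 1 :
      Matrix (Option ι) (Option ι) ℝ).IsSymm := by
  unfold Matrix.IsSymm
  rw [transpose_add, Matrix.transpose_single, Matrix.transpose_single, add_comm]

/-- Hence `1 − ∑ xᵢ²` is a real zero polynomial (Rem. 2.2 (i) for this pencil).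
[cite: NetzerThom2012, Example 2.16] -/
theorem isRZPoly_one_sub_sum_sq :
    IsRZPoly (1 - ∑ i, MvPolynomial.X i ^ 2 : MvPolynomial ι ℝ) := by
  rw [← example_2_16]
  exact isRZPoly_monicPencilDet _ example_2_16_isSymm

end Example216

/-! ## Proposition 2.6 and Theorem 2.7: a full-dimensional cone in `S(𝓜)` forces size `d` -/

section Thm27

variable {ι : Type*} [Fintype ι] {k : Type*} [Fintype k] [DecidableEq k]

/-- `|xᵀAx| ≤ (∑ₗⱼ |Aₗⱼ|)·‖x‖²`. [folklore] -/
private theorem abs_dotProduct_mulVec_le {m : Type*} [Fintype m] (A : Matrix m m ℝ) (x : m → ℝ) :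
    |x ⬝ᵥ (A *ᵥ x)| ≤ (∑ l, ∑ j, |A l j|) * (x ⬝ᵥ x) := by
  have hx : ∀ l, x l * x l ≤ x ⬝ᵥ x := fun l =>
    Finset.single_le_sum (f := fun i => x i * x i) (fun i _ => mul_self_nonneg (x i))
      (Finset.mem_univ l)
  calc |x ⬝ᵥ (A *ᵥ x)| = |∑ l, ∑ j, x l * (A l j * x j)| := by
        simp only [dotProduct, mulVec, Finset.mul_sum]
    _ ≤ ∑ l, ∑ j, |x l * (A l j * x j)| :=
        (Finset.abs_sum_le_sum_abs _ _).trans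
          (Finset.sum_le_sum fun l _ => Finset.abs_sum_le_sum_abs _ _)
    _ ≤ ∑ l, ∑ j, |A l j| * (x ⬝ᵥ x) :=
        Finset.sum_le_sum fun l _ => Finset.sum_le_sum fun j _ => by
          rw [abs_mul, abs_mul, mul_left_comm]
          refine mul_le_mul_of_nonneg_left ?_ (abs_nonneg _)
          have h2 : 2 * |x l| * |x j| ≤ |x l| ^ 2 + |x j| ^ 2 := two_mul_le_add_sq _ _
          rw [sq_abs, sq_abs, sq, sq] at h2
          linarith [hx l, hx j]
    _ = (∑ l, ∑ j, |A l j|) * (x ⬝ᵥ x) := by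
        rw [Finset.sum_mul]
        exact Finset.sum_congr rfl fun l _ => by rw [Finset.sum_mul]

/-- For a real symmetric `A` and a diagonal matrix `Λ` with positive diagonal, `A + μΛ ≻ 0` and
`μΛ − A ≻ 0` for `μ` large ("the upper left block has arbitrarily large eigenvalues for `λ` big
enough" in the printed proof of Prop. 2.6). [folklore] -/
private theorem exists_posDef_add_smul_diagonal {m : Type*} [Fintype m] [DecidableEq m]
    (A : Matrix m m ℝ) (hA : A.IsSymm) (w : m → ℝ) (hw : ∀ j, 0 < w j) :
    ∃ μ : ℝ, (A + μ • diagonal w).PosDef ∧ (μ • diagonal w - A).PosDef := by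
  set K : ℝ := ∑ l, ∑ j, |A l j| with hK
  have hK0 : 0 ≤ K := Finset.sum_nonneg fun l _ => Finset.sum_nonneg fun j _ => abs_nonneg _
  set μ : ℝ := ∑ j, (K + 1) / w j with hμdef
  have hμ : ∀ j, K + 1 ≤ μ * w j := fun j => by
    have h1 : (K + 1) / w j ≤ μ :=
      Finset.single_le_sum (f := fun j' => (K + 1) / w j')
        (fun j' _ => div_nonneg (by linarith) (hw j').le) (Finset.mem_univ j)
    calc K + 1 = (K + 1) / w j * w j := by rw [div_mul_cancel₀ _ (hw j).ne']
      _ ≤ μ * w j := mul_le_mul_of_nonneg_right h1 (hw j).le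
  have hdiag : ∀ x : m → ℝ, (K + 1) * (x ⬝ᵥ x) ≤ x ⬝ᵥ ((μ • diagonal w) *ᵥ x) := fun x => by
    simp only [dotProduct, smul_mulVec, Pi.smul_apply, mulVec_diagonal, smul_eq_mul,
      Finset.mul_sum]
    refine Finset.sum_le_sum fun i _ => ?_
    have h := mul_nonneg (sub_nonneg.mpr (hμ i)) (mul_self_nonneg (x i))
    nlinarith [h]
  have hAx : ∀ x : m → ℝ, |x ⬝ᵥ (A *ᵥ x)| ≤ K * (x ⬝ᵥ x) := abs_dotProduct_mulVec_le A
  have hxx : ∀ x : m → ℝ, x ≠ 0 → 0 < x ⬝ᵥ x := fun x hx =>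
    lt_of_le_of_ne (Finset.sum_nonneg fun i _ => mul_self_nonneg _)
      (Ne.symm (mt dotProduct_self_eq_zero.mp hx))
  have hsymm : (diagonal w).IsSymm := by
    unfold Matrix.IsSymm
    exact diagonal_transpose w
  refine ⟨μ, ?_, ?_⟩
  · refine PosDef.of_dotProduct_mulVec_pos
      (isHermitian_iff_isSymm.mpr (hA.add (hsymm.smul μ))) fun x hx => ?_
    rw [star_trivial, add_mulVec, dotProduct_add]
    have h1 := (abs_le.mp (hAx x)).1
    linarith [hdiag x, hxx x hx]
  · refine PosDef.of_dotProduct_mulVec_pos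
      (isHermitian_iff_isSymm.mpr ((hsymm.smul μ).sub hA)) fun x hx => ?_
    rw [star_trivial, sub_mulVec, dotProduct_sub]
    have h1 := (abs_le.mp (hAx x)).2
    linarith [hdiag x, hxx x hx]

/-- A square real matrix of rank `< size` has determinant `0`. [folklore] -/
private theorem det_eq_zero_of_rank_lt {m : Type*} [Fintype m] [DecidableEq m] (N : Matrix m m ℝ)
    (h : N.rank < Fintype.card m) : N.det = 0 := by
  by_contra hne
  have hunit : IsUnit N := (Matrix.isUnit_iff_isUnit_det N).mpr (isUnit_iff_ne_zero.mpr hne)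
  rw [Matrix.rank_of_isUnit N hunit] at h
  exact lt_irrefl _ h

/-- **Netzer–Thom 2012, Prop. 2.6 (real symmetric case, kernel form).** Let `G, W` be real
symmetric with `W ⪰ 0` and suppose every `G + μW`, `μ ∈ ℝ`, has rank at most `rank W`
(printed: `V ⊆ Sym_k(ℝ)` a subspace all of whose elements have rank `≤ d`, containing a
positive semidefinite matrix of rank `d`; apply this to `V ∋ G, W`).  Then `ker W ⊆ ker G` —
equivalently, in an orthonormal eigenbasis of `W` every such `G` has the block form
`[[A, 0], [0, 0]]` with `A` of size `rank W`, which is the printed conclusion `QᵀVQ ⊆ {A ⊕ 0}`.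
Proof as printed (Schur complements of the `(d+1) × (d+1)` compressions
`[[A + μΛ, b], [bᵀ, c]]`, singular for every `μ`), with the limit `λ → ∞` replaced by comparing
one `μ` with `A + μΛ ≻ 0` and one with `A + μΛ ≺ 0`: they give `c ≥ 0` and `c ≤ 0`.
TODO(hermitian form). [cite: NetzerThom2012, Prop. 2.6] -/
theorem prop_2_6 (G W : Matrix k k ℝ) (hG : G.IsSymm) (hW : W.PosSemidef)
    (hrank : ∀ μ : ℝ, (G + μ • W).rank ≤ W.rank) (u : k → ℝ) (hu : W *ᵥ u = 0) :
    G *ᵥ u = 0 := by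
  classical
  have hWh : W.IsHermitian := hW.1
  have hWs : W.IsSymm := isHermitian_iff_isSymm.mp hWh
  set U : Matrix k k ℝ := (hWh.eigenvectorUnitary : Matrix k k ℝ) with hU
  have hUU : U * Uᵀ = 1 := by
    have h := Matrix.mem_unitaryGroup_iff.mp (hWh.eigenvectorUnitary).2
    rwa [star_eq_conjTranspose, conjTranspose_eq_transpose_of_trivial] at h
  have hUU' : Uᵀ * U = 1 := by
    have h := Matrix.mem_unitaryGroup_iff'.mp (hWh.eigenvectorUnitary).2
    rwa [star_eq_conjTranspose, conjTranspose_eq_transpose_of_trivial] at h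
  have hcol : ∀ j, W *ᵥ (Uᵀ j) = hWh.eigenvalues j • Uᵀ j := fun j => by
    rw [hU, Matrix.IsHermitian.eigenvectorUnitary_transpose_apply, hWh.mulVec_eigenvectorBasis]
  have hpos : ∀ j : {j : k // hWh.eigenvalues j ≠ 0}, 0 < hWh.eigenvalues j.1 := fun j =>
    lt_of_le_of_ne (hW.eigenvalues_nonneg j.1) (Ne.symm j.2)
  let Q₁ : Matrix k {j : k // hWh.eigenvalues j ≠ 0} ℝ := fun a j => U a j
  let Q₀ : Matrix k {j : k // ¬ hWh.eigenvalues j ≠ 0} ℝ := fun a j => U a j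
  have hQQ : Q₁ᵀ * Q₁ = 1 := by
    ext j j'
    have h := congr_fun (congr_fun hUU' j.1) j'.1
    simp only [Matrix.mul_apply, Matrix.transpose_apply, Matrix.one_apply] at h ⊢
    simp only [Q₁, Subtype.ext_iff]
    exact h
  have hWQ : W * Q₁ = Q₁ * diagonal (fun j : {j : k // hWh.eigenvalues j ≠ 0} =>
      hWh.eigenvalues j.1) := by
    ext a j
    rw [Matrix.mul_diagonal, Matrix.mul_apply]
    have h := congr_fun (hcol j.1) a
    simp only [Matrix.mulVec, dotProduct, Matrix.transpose_apply, Pi.smul_apply, smul_eq_mul] at h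
    simp only [Q₁]
    rw [h, mul_comm]
  have hsplit : U * Uᵀ = Q₁ * Q₁ᵀ + Q₀ * Q₀ᵀ := by
    ext a a'
    simp only [Matrix.mul_apply, Matrix.add_apply, Matrix.transpose_apply, Q₁, Q₀]
    exact (Fintype.sum_subtype_add_sum_subtype (fun j => hWh.eigenvalues j ≠ 0)
      (fun j => U a j * U a' j)).symm
  have hWQ₀ : W * Q₀ = 0 := by
    ext a j
    have h := congr_fun (hcol j.1) a
    rw [not_not.mp j.2, zero_smul] at h
    simpa [Q₀, Matrix.mul_apply, Matrix.mulVec, dotProduct] using h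
  have hWQQ : W * (Q₁ * Q₁ᵀ) = W := by
    have h : W * (U * Uᵀ) = W * (Q₁ * Q₁ᵀ) + W * Q₀ * Q₀ᵀ := by
      rw [hsplit, Matrix.mul_add, Matrix.mul_assoc]
    rw [hUU, Matrix.mul_one, hWQ₀, Matrix.zero_mul, add_zero] at h
    exact h.symm
  -- Step A: for every `v ∈ ker W`, the compression `[Q₁ | v]ᵀ (G + μW) [Q₁ | v]` is singular for
  -- all `μ`; Schur complements at `±μ` large give `vᵀGv = 0` and `Q₁ᵀGv = 0`.
  have stepA : ∀ v : k → ℝ, W *ᵥ v = 0 → v ⬝ᵥ (G *ᵥ v) = 0 ∧ (Q₁ᵀ * G) *ᵥ v = 0 := by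
    intro v hv
    set Λ : Matrix {j : k // hWh.eigenvalues j ≠ 0} {j : k // hWh.eigenvalues j ≠ 0} ℝ :=
      diagonal fun j => hWh.eigenvalues j.1 with hΛ
    set A : Matrix {j : k // hWh.eigenvalues j ≠ 0} {j : k // hWh.eigenvalues j ≠ 0} ℝ :=
      Q₁ᵀ * G * Q₁ with hA
    have hAs : A.IsSymm := isSymm_conj G hG Q₁
    let vc : Matrix k Unit ℝ := fun a _ => v a
    set b : Matrix {j : k // hWh.eigenvalues j ≠ 0} Unit ℝ := Q₁ᵀ * G * vc with hb
    set C : Matrix Unit Unit ℝ := vcᵀ * G * vc with hC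
    set bv : {j : k // hWh.eigenvalues j ≠ 0} → ℝ := fun j => b j () with hbv
    have hWvc : W * vc = 0 := by
      ext a s
      simpa [vc, Matrix.mul_apply, Matrix.mulVec, dotProduct] using congr_fun hv a
    have hvcW : vcᵀ * W = 0 := by
      have h := congr_arg transpose hWvc
      rwa [transpose_mul, transpose_zero, hWs.eq] at h
    have hQW : Q₁ᵀ * W = Λ * Q₁ᵀ := by
      have h := congr_arg transpose hWQ
      rwa [transpose_mul, hWs.eq, transpose_mul, diagonal_transpose] at h
    have hb11 : ∀ μ : ℝ, Q₁ᵀ * (G + μ • W) * Q₁ = A + μ • Λ := fun μ => by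
      rw [Matrix.mul_add, Matrix.add_mul, ← hA, Matrix.mul_smul, Matrix.smul_mul, hQW,
        Matrix.mul_assoc, hQQ, Matrix.mul_one]
    have hb12 : ∀ μ : ℝ, Q₁ᵀ * (G + μ • W) * vc = b := fun μ => by
      rw [Matrix.mul_add, Matrix.add_mul, ← hb, Matrix.mul_smul, Matrix.smul_mul,
        Matrix.mul_assoc, hWvc, Matrix.mul_zero, smul_zero, add_zero]
    have hb21 : ∀ μ : ℝ, vcᵀ * (G + μ • W) * Q₁ = bᵀ := fun μ => by
      rw [Matrix.mul_add, Matrix.add_mul, Matrix.mul_smul, Matrix.smul_mul, hvcW,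
        Matrix.zero_mul, smul_zero, add_zero, hb, transpose_mul, transpose_mul,
        transpose_transpose, hG.eq, Matrix.mul_assoc]
    have hb22 : ∀ μ : ℝ, vcᵀ * (G + μ • W) * vc = C := fun μ => by
      rw [Matrix.mul_add, Matrix.add_mul, ← hC, Matrix.mul_smul, Matrix.smul_mul, hvcW,
        Matrix.zero_mul, smul_zero, add_zero]
    have hblock : ∀ μ : ℝ, (fromCols Q₁ vc)ᵀ * (G + μ • W) * fromCols Q₁ vc =
        Matrix.fromBlocks (A + μ • Λ) b bᵀ C := fun μ => by
      rw [transpose_fromCols, fromRows_mul, fromRows_mul_fromCols, hb11, hb12, hb21, hb22]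
    have hdet : ∀ μ : ℝ, (Matrix.fromBlocks (A + μ • Λ) b bᵀ C).det = 0 := fun μ => by
      rw [← hblock μ]
      refine det_eq_zero_of_rank_lt _ ?_
      calc ((fromCols Q₁ vc)ᵀ * (G + μ • W) * fromCols Q₁ vc).rank
          ≤ ((fromCols Q₁ vc)ᵀ * (G + μ • W)).rank := Matrix.rank_mul_le_left _ _
        _ ≤ (G + μ • W).rank := Matrix.rank_mul_le_right _ _
        _ ≤ W.rank := hrank μ
        _ = Fintype.card {j : k // hWh.eigenvalues j ≠ 0} := hWh.rank_eq_card_non_zero_eigs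
        _ < Fintype.card ({j : k // hWh.eigenvalues j ≠ 0} ⊕ Unit) := by simp
    -- Schur complement at an invertible top-left block
    have key : ∀ T : Matrix {j : k // hWh.eigenvalues j ≠ 0} {j : k // hWh.eigenvalues j ≠ 0} ℝ,
        IsUnit T.det → (Matrix.fromBlocks T b bᵀ C).det = 0 →
        ∃ y, T *ᵥ y = bv ∧ C () () = y ⬝ᵥ (T *ᵥ y) := by
      intro T hT h0
      letI := Matrix.invertibleOfIsUnitDet T hT
      rw [Matrix.det_fromBlocks₁₁, mul_eq_zero] at h0
      rcases h0 with h0 | h0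
      · exact absurd h0 hT.ne_zero
      rw [Matrix.det_unique, Matrix.sub_apply, sub_eq_zero] at h0
      refine ⟨⅟T *ᵥ bv, by rw [mulVec_mulVec, mul_invOf_self, one_mulVec], ?_⟩
      rw [mulVec_mulVec, mul_invOf_self, one_mulVec, h0, dotProduct_comm]
      simp only [Matrix.mul_apply, Matrix.transpose_apply, dotProduct, Matrix.mulVec, Finset.sum_mul,
        Finset.mul_sum, hbv]
      rw [Finset.sum_comm]
      exact Finset.sum_congr rfl fun i _ => Finset.sum_congr rfl fun j _ => by ring
    obtain ⟨μ, hpd, hnd⟩ := exists_posDef_add_smul_diagonal A hAs _ hpos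
    have hTp : IsUnit (A + μ • Λ).det := (Matrix.isUnit_iff_isUnit_det _).mp hpd.isUnit
    have hneg : A + (-μ) • Λ = -(μ • Λ - A) := by rw [neg_sub, neg_smul, sub_eq_add_neg]
    have hTm : IsUnit (A + (-μ) • Λ).det := by
      rw [hneg]
      exact (Matrix.isUnit_iff_isUnit_det _).mp hnd.isUnit.neg
    obtain ⟨yp, hyp, hcp⟩ := key _ hTp (hdet μ)
    obtain ⟨ym, hym, hcm⟩ := key _ hTm (hdet (-μ))
    have hge : 0 ≤ C () () := by
      rw [hcp]
      simpa only [star_trivial] using hpd.posSemidef.dotProduct_mulVec_nonneg yp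
    have hle : C () () ≤ 0 := by
      rw [hcm, hneg, neg_mulVec, dotProduct_neg, neg_nonpos]
      simpa only [star_trivial] using hnd.posSemidef.dotProduct_mulVec_nonneg ym
    have hC0 : C () () = 0 := le_antisymm hle hge
    have hy0 : yp = 0 := by
      by_contra hy
      have h := hpd.dotProduct_mulVec_pos hy
      rw [star_trivial, ← hcp, hC0] at h
      exact lt_irrefl _ h
    have hbv0 : bv = 0 := by rw [← hyp, hy0, mulVec_zero]
    refine ⟨?_, ?_⟩
    · rw [← hC0, hC]
      simp only [Matrix.mul_apply, Matrix.transpose_apply, dotProduct, Matrix.mulVec, Finset.sum_mul,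
        Finset.mul_sum, vc]
      rw [Finset.sum_comm]
      exact Finset.sum_congr rfl fun i _ => Finset.sum_congr rfl fun j _ => by ring
    · funext j
      have h := congr_fun hbv0 j
      simp only [hbv, hb, Pi.zero_apply, Matrix.mul_apply, vc] at h
      simpa [Matrix.mulVec, dotProduct, Matrix.mul_apply] using h
  -- Step B: polarisation on `ker W` and the decomposition `y = Q₁Q₁ᵀy + (y − Q₁Q₁ᵀy)`.
  have hform : ∀ x y : k → ℝ, x ⬝ᵥ (G *ᵥ y) = y ⬝ᵥ (G *ᵥ x) := fun x y => by
    rw [dotProduct_mulVec, ← mulVec_transpose, hG.eq, dotProduct_comm]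
  have hpolar : ∀ v v' : k → ℝ, W *ᵥ v = 0 → W *ᵥ v' = 0 → v' ⬝ᵥ (G *ᵥ v) = 0 := by
    intro v v' hv hv'
    have h := (stepA (v + v') (by rw [mulVec_add, hv, hv', add_zero])).1
    rw [mulVec_add, add_dotProduct, dotProduct_add, dotProduct_add, (stepA v hv).1,
      (stepA v' hv').1, hform v v'] at h
    linarith
  have hGu : ∀ y : k → ℝ, y ⬝ᵥ (G *ᵥ u) = 0 := by
    intro y
    set r := y - (Q₁ * Q₁ᵀ) *ᵥ y with hr
    have hrW : W *ᵥ r = 0 := by rw [hr, mulVec_sub, mulVec_mulVec, hWQQ, sub_self]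
    have hy : y = (Q₁ * Q₁ᵀ) *ᵥ y + r := by rw [hr]; abel
    rw [hy, add_dotProduct, hpolar u r hu hrW, add_zero, ← mulVec_mulVec,
      ← vecMul_transpose Q₁ (Q₁ᵀ *ᵥ y), ← dotProduct_mulVec (Q₁ᵀ *ᵥ y) Q₁ᵀ (G *ᵥ u),
      mulVec_mulVec, (stepA u hu).2, dotProduct_zero]
  exact dotProduct_self_eq_zero.mp (hGu (G *ᵥ u))

/-- **Netzer–Thom 2012, Thm. 2.7 (real symmetric case), matrix form.** Let
`𝓜 = I + ∑ xᵢMᵢ` be a real symmetric monic pencil, `p = det 𝓜` of degree `d`, and suppose some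
`W = ∑ aᵢMᵢ` is positive semidefinite of rank `d` (this is what a full-dimensional cone in
`S(𝓜)` provides, see `thm_2_7`).  Then by Cor. 2.3 and Prop. 2.6 every `Mᵢ` kills `ker W`, and
the `d` eigenvector columns `Q` of `W` with non-zero eigenvalue satisfy `MᵢQQᵀ = Mᵢ`; so the
`d × d` symmetric pencil `I + ∑ xᵢQᵀMᵢQ` has determinant `p`.
[cite: NetzerThom2012, Thm. 2.7 (proof)] -/
theorem thm_2_7_pencil (M : ι → Matrix k k ℝ) (hM : ∀ i, (M i).IsSymm) (a : ι → ℝ)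
    (hpsd : (∑ i, a i • M i).PosSemidef)
    (hrank : (∑ i, a i • M i).rank = (monicPencilDet M).totalDegree) :
    ∃ Q : Matrix k (Fin (monicPencilDet M).totalDegree) ℝ,
      (∀ i, M i * (Q * Qᵀ) = M i) ∧ (∀ i, (Qᵀ * M i * Q).IsSymm) ∧
        monicPencilDet (fun i => Qᵀ * M i * Q) = monicPencilDet M := by
  classical
  set W : Matrix k k ℝ := ∑ i, a i • M i with hWdef
  have hWh : W.IsHermitian := hpsd.1
  -- Prop. 2.6 applies to each `Mᵢ`: `Mᵢ + μW` lies in the pencil span, so its rank is `≤ deg p`.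
  have hker : ∀ i u, W *ᵥ u = 0 → M i *ᵥ u = 0 := by
    intro i u hu
    refine prop_2_6 (M i) W (hM i) hpsd (fun μ => ?_) u hu
    have h : M i + μ • W = ∑ j, (Pi.single i (1 : ℝ) + μ • a : ι → ℝ) j • M j := by
      simp only [hWdef, Pi.add_apply, Pi.smul_apply, smul_eq_mul, add_smul, Finset.sum_add_distrib,
        mul_smul, ← Finset.smul_sum]
      congr 1
      rw [Fintype.sum_eq_single i (fun j hj => by rw [Pi.single_eq_of_ne hj, zero_smul]),
        Pi.single_eq_same, one_smul]
    rw [h, hrank]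
    exact cor_2_3 M hM _
  set U : Matrix k k ℝ := (hWh.eigenvectorUnitary : Matrix k k ℝ) with hU
  have hUU : U * Uᵀ = 1 := by
    have h := Matrix.mem_unitaryGroup_iff.mp (hWh.eigenvectorUnitary).2
    rwa [star_eq_conjTranspose, conjTranspose_eq_transpose_of_trivial] at h
  have hcol0 : ∀ j, hWh.eigenvalues j = 0 → ∀ i, M i *ᵥ (Uᵀ j) = 0 := by
    intro j hj i
    refine hker i _ ?_
    rw [hU, Matrix.IsHermitian.eigenvectorUnitary_transpose_apply, hWh.mulVec_eigenvectorBasis, hj,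
      zero_smul]
  let Q₁ : Matrix k {j : k // hWh.eigenvalues j ≠ 0} ℝ := fun x j => U x j
  let Q₀ : Matrix k {j : k // ¬ hWh.eigenvalues j ≠ 0} ℝ := fun x j => U x j
  have hsplit : U * Uᵀ = Q₁ * Q₁ᵀ + Q₀ * Q₀ᵀ := by
    ext x y
    simp only [Matrix.mul_apply, Matrix.add_apply, Matrix.transpose_apply, Q₁, Q₀]
    exact (Fintype.sum_subtype_add_sum_subtype (fun j => hWh.eigenvalues j ≠ 0)
      (fun j => U x j * U y j)).symm
  have hQ₀ : ∀ i, M i * Q₀ = 0 := fun i => by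
    ext x j
    have h := congr_fun (hcol0 j.1 (not_not.mp j.2) i) x
    simpa [Q₀, Matrix.mul_apply, Matrix.mulVec, dotProduct] using h
  have hQ₁ : ∀ i, M i * (Q₁ * Q₁ᵀ) = M i := fun i => by
    have h : M i * (U * Uᵀ) = M i * (Q₁ * Q₁ᵀ) + M i * Q₀ * Q₀ᵀ := by
      rw [hsplit, Matrix.mul_add, Matrix.mul_assoc]
    rw [hUU, Matrix.mul_one, hQ₀ i, Matrix.zero_mul, add_zero] at h
    exact h.symm
  have hcard : Fintype.card {j : k // hWh.eigenvalues j ≠ 0} = (monicPencilDet M).totalDegree := by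
    rw [← hWh.rank_eq_card_non_zero_eigs]
    exact hrank
  let e := Fintype.equivFinOfCardEq hcard
  let Q : Matrix k (Fin (monicPencilDet M).totalDegree) ℝ := fun x t => Q₁ x (e.symm t)
  have hQQ1 : Q * Qᵀ = Q₁ * Q₁ᵀ := by
    ext x y
    simp only [Matrix.mul_apply, Matrix.transpose_apply, Q]
    exact Fintype.sum_equiv e.symm _ _ fun t => rfl
  have hQ : ∀ i, M i * (Q * Qᵀ) = M i := fun i => by rw [hQQ1, hQ₁ i]
  exact ⟨Q, hQ, fun i => isSymm_conj _ (hM i) Q, monicPencilDet_conj M Q hQ⟩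

/-- The two facts the printed proof of Thm. 2.7 draws from a full-dimensional cone in `S(𝓜)`:
a direction `a` whose whole ray `ℝ₊ a` lies in `S(𝓜)` has `∑ aᵢMᵢ ⪰ 0`, and since the rank of
`∑ aᵢMᵢ` is generically `deg p` (Cor. 2.3) some direction of a nonempty open set of such
directions has rank exactly `deg p`. [cite: NetzerThom2012, Thm. 2.7 (proof)] -/
theorem exists_posSemidef_rank_eq (M : ι → Matrix k k ℝ) (hM : ∀ i, (M i).IsSymm)
    (hcone : ∃ O : Set (ι → ℝ), IsOpen O ∧ O.Nonempty ∧
      ∀ a ∈ O, ∀ t : ℝ, 0 ≤ t → (1 + ∑ i, (t • a) i • M i).PosSemidef) :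
    ∃ a : ι → ℝ, (∑ i, a i • M i).PosSemidef ∧
      (∑ i, a i • M i).rank = (monicPencilDet M).totalDegree := by
  classical
  obtain ⟨O, hO, ⟨a₀, ha₀⟩, hray⟩ := hcone
  -- a ray in `S(𝓜)` gives a positive semidefinite direction matrix
  have hpsd : ∀ a ∈ O, (∑ i, a i • M i).PosSemidef := by
    intro a ha
    refine PosSemidef.of_dotProduct_mulVec_nonneg
      (isHermitian_iff_isSymm.mpr (isSymm_sum_smul M hM a)) fun x => ?_
    rw [star_trivial]
    by_contra hneg
    rw [not_le] at hneg
    set q : ℝ := x ⬝ᵥ ((∑ i, a i • M i) *ᵥ x) with hq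
    have hxx : 0 ≤ x ⬝ᵥ x := Finset.sum_nonneg fun i _ => mul_self_nonneg _
    have ht : 0 ≤ (x ⬝ᵥ x + 1) / (-q) := div_nonneg (by linarith) (by linarith)
    have h := (hray a ha _ ht).dotProduct_mulVec_nonneg x
    have e : (1 : Matrix k k ℝ) + ∑ i, (((x ⬝ᵥ x + 1) / (-q)) • a) i • M i =
        1 + ((x ⬝ᵥ x + 1) / (-q)) • ∑ i, a i • M i := by
      simp only [Pi.smul_apply, smul_eq_mul, mul_smul, ← Finset.smul_sum]
    rw [e, star_trivial, add_mulVec, one_mulVec, dotProduct_add, smul_mulVec, dotProduct_smul,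
      smul_eq_mul, ← hq] at h
    have hq0 : q ≠ 0 := ne_of_lt hneg
    have hqq : (x ⬝ᵥ x + 1) / (-q) * q = -(x ⬝ᵥ x + 1) := by
      rw [div_mul_eq_mul_div, mul_div_assoc, div_neg_self hq0, mul_neg_one]
    linarith
  -- the top form of `p` does not vanish identically on the open set `O`
  have hp0 : monicPencilDet M ≠ 0 := fun h => by
    have h1 := eval_zero_monicPencilDet M
    rw [h, map_zero] at h1
    exact zero_ne_one h1
  have hq := homogeneousComponent_totalDegree_ne_zero hp0
  obtain ⟨ε, hε, hball⟩ := Metric.isOpen_iff.mp hO a₀ ha₀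
  by_contra hnone
  refine hq (MvPolynomial.funext_set (fun i => Metric.ball (a₀ i) ε) (fun i => ?_) (fun x hx => ?_))
  · rw [Real.ball_eq_Ioo]
    exact Set.Ioo_infinite (by linarith)
  · rw [map_zero]
    have hxO : x ∈ O := hball (by rw [ball_pi _ hε]; exact hx)
    by_contra hx0
    exact hnone ⟨x, hpsd x hxO, rank_sum_smul_eq_totalDegree M hM hx0⟩

/-- **Netzer–Thom 2012, Thm. 2.7 (real symmetric case).** Let `𝓜 = I + x₁M₁ + ⋯ + xₙMₙ` be a
real symmetric linear matrix polynomial and `d = deg p`, `p = det 𝓜`.  If the spectrahedron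
`S(𝓜) = {a : 𝓜(a) ⪰ 0}` contains a full-dimensional cone — rendered as: a nonempty open set of
directions `a` whose closed rays `{t a : t ≥ 0}` lie in `S(𝓜)` — then `p` is the determinant of a
real symmetric monic pencil of size `d`.  (Printed "hermitian/symmetric"; a generalisation of
Brändén's Thm. 2.2.) TODO(hermitian form). [cite: NetzerThom2012, Thm. 2.7] -/
theorem thm_2_7 (M : ι → Matrix k k ℝ) (hM : ∀ i, (M i).IsSymm)
    (hcone : ∃ O : Set (ι → ℝ), IsOpen O ∧ O.Nonempty ∧
      ∀ a ∈ O, ∀ t : ℝ, 0 ≤ t → (1 + ∑ i, (t • a) i • M i).PosSemidef) :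
    ∃ M' : ι → Matrix (Fin (monicPencilDet M).totalDegree)
        (Fin (monicPencilDet M).totalDegree) ℝ,
      (∀ i, (M' i).IsSymm) ∧ monicPencilDet M' = monicPencilDet M := by
  obtain ⟨a, hpsd, hrank⟩ := exists_posSemidef_rank_eq M hM hcone
  obtain ⟨Q, -, hs, hd⟩ := thm_2_7_pencil M hM a hpsd hrank
  exact ⟨_, hs, hd⟩

end Thm27

/-! ## Lemmas 2.13–2.14: the real symmetric doubling of a hermitian matrix / pencil -/

section Lemma213

variable {n : Type*} [Fintype n] [DecidableEq n]

/-- The complex change of basis behind the doubling: `[[A, B], [−B, A]]·P = P·diag(A + iB, A − iB)`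
for `P = [[I, I], [iI, −iI]]`, valid for all complex square `A, B`. [folklore] -/
private theorem doubling_mul_P (A B : Matrix n n ℂ) :
    Matrix.fromBlocks A B (-B) A *
        Matrix.fromBlocks (1 : Matrix n n ℂ) (1 : Matrix n n ℂ) (Complex.I • (1 : Matrix n n ℂ))
        (-(Complex.I • (1 : Matrix n n ℂ))) =
      Matrix.fromBlocks (1 : Matrix n n ℂ) (1 : Matrix n n ℂ) (Complex.I • (1 : Matrix n n ℂ))
        (-(Complex.I • (1 : Matrix n n ℂ))) *
        Matrix.fromBlocks (A + Complex.I • B) 0 0 (A - Complex.I • B) := by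
  rw [Matrix.fromBlocks_multiply, Matrix.fromBlocks_multiply]
  simp only [Matrix.mul_one, Matrix.one_mul, Matrix.mul_zero, zero_add, add_zero,
    Matrix.mul_neg, Matrix.neg_mul, Matrix.mul_smul, Matrix.smul_mul, smul_add, smul_sub,
    smul_smul, Complex.I_mul_I, neg_one_smul]
  congr 1 <;> abel

/-- `P = [[I, I], [iI, −iI]]` is invertible: `det P = (−2i)^n`. [folklore] -/
private theorem isUnit_det_P :
    IsUnit (Matrix.fromBlocks (1 : Matrix n n ℂ) (1 : Matrix n n ℂ) (Complex.I • (1 : Matrix n n ℂ))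
        (-(Complex.I • (1 : Matrix n n ℂ)))).det := by
  rw [Matrix.det_fromBlocks_one₁₁, Matrix.mul_one, ← neg_smul, ← sub_smul, Matrix.det_smul,
    Matrix.det_one, mul_one]
  refine isUnit_iff_ne_zero.mpr (pow_ne_zero _ ?_)
  rw [← neg_add', neg_ne_zero, ← two_mul]
  exact mul_ne_zero two_ne_zero Complex.I_ne_zero

omit [Fintype n] [DecidableEq n] in
/-- Real and imaginary parts of a hermitian matrix: `Re M` is symmetric, `Im M` is skew.
[cite: NetzerThom2012, Lemma 2.13 (statement)] -/
theorem transpose_map_re_of_isHermitian (M : Matrix n n ℂ) (hM : M.IsHermitian) :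
    (M.map Complex.re)ᵀ = M.map Complex.re ∧ (M.map Complex.im)ᵀ = -M.map Complex.im := by
  constructor
  · ext i j
    have h := congr_arg Complex.re (hM.apply i j)
    simpa using h
  · ext i j
    have h := congr_arg Complex.im (hM.apply i j)
    simp only [Complex.star_def, Complex.conj_im] at h
    simp only [Matrix.transpose_apply, Matrix.map_apply, Matrix.neg_apply]
    linarith

omit [Fintype n] [DecidableEq n] in
/-- **Netzer–Thom 2012, Lemma 2.13 (symmetry of the doubling).** For `M = R + iS ∈ H_k(ℂ)`
(`R` real symmetric, `S` real skew-symmetric) the real `2k × 2k` matrix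
`M̃ = [[R, S], [−S, R]]` is symmetric. [cite: NetzerThom2012, Lemma 2.13] -/
theorem lemma_2_13_isSymm (M : Matrix n n ℂ) (hM : M.IsHermitian) :
    (Matrix.fromBlocks (M.map Complex.re) (M.map Complex.im) (-M.map Complex.im)
      (M.map Complex.re)).IsSymm := by
  obtain ⟨hR, hS⟩ := transpose_map_re_of_isHermitian M hM
  unfold Matrix.IsSymm
  rw [Matrix.fromBlocks_transpose, Matrix.transpose_neg, hR, hS, neg_neg]

/-- The doubling `M̃`, base-changed to `ℂ`, is similar to `diag(M, Mᵀ)` via `P`.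
[cite: NetzerThom2012, Lemma 2.13 (proof)] -/
private theorem doubling_map_eq_conj (M : Matrix n n ℂ) (hM : M.IsHermitian) :
    (Matrix.fromBlocks (M.map Complex.re) (M.map Complex.im) (-M.map Complex.im)
        (M.map Complex.re)).map (algebraMap ℝ ℂ) =
      Matrix.fromBlocks (1 : Matrix n n ℂ) (1 : Matrix n n ℂ) (Complex.I • (1 : Matrix n n ℂ))
        (-(Complex.I • (1 : Matrix n n ℂ))) *
        Matrix.fromBlocks M 0 0 Mᵀ *
        (Matrix.fromBlocks (1 : Matrix n n ℂ) (1 : Matrix n n ℂ) (Complex.I • (1 : Matrix n n ℂ))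
        (-(Complex.I • (1 : Matrix n n ℂ))))⁻¹ := by
  set Rc : Matrix n n ℂ := (M.map Complex.re).map (algebraMap ℝ ℂ) with hRc
  set Sc : Matrix n n ℂ := (M.map Complex.im).map (algebraMap ℝ ℂ) with hSc
  have hmap : (Matrix.fromBlocks (M.map Complex.re) (M.map Complex.im) (-M.map Complex.im)
      (M.map Complex.re)).map (algebraMap ℝ ℂ) = Matrix.fromBlocks Rc Sc (-Sc) Rc := by
    rw [Matrix.fromBlocks_map]
    congr 1
    ext i j
    simp [hSc]
  have hdec : Rc + Complex.I • Sc = M := by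
    ext i j
    simp only [hRc, hSc, Matrix.add_apply, Matrix.map_apply, Matrix.smul_apply, smul_eq_mul,
      Complex.coe_algebraMap]
    rw [mul_comm, Complex.re_add_im]
  have hdec' : Rc - Complex.I • Sc = Mᵀ := by
    ext i j
    have h := hM.apply j i
    rw [Matrix.transpose_apply, ← h]
    simp only [hRc, hSc, Matrix.sub_apply, Matrix.map_apply, Matrix.smul_apply, smul_eq_mul,
      Complex.coe_algebraMap, Complex.star_def]
    apply Complex.ext <;> simp
  rw [hmap]
  have h := doubling_mul_P Rc Sc
  rw [hdec, hdec'] at h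
  rw [← h, Matrix.mul_nonsing_inv_cancel_right _ _ isUnit_det_P]

/-- **Netzer–Thom 2012, Lemma 2.13.** For `M ∈ H_k(ℂ)` write `M = R + iS` with `R` real
symmetric and `S` real skew-symmetric, and let `M̃ = [[R, S], [−S, R]]`, a real symmetric
matrix of size `2k`.  Then `M̃` has the same eigenvalues as `M` with doubled multiplicities:
`χ_{M̃} = χ_M²` (characteristic polynomials, `χ_{M̃}` read in `ℂ[t]`; for hermitian `M`,
`χ_{Mᵀ} = χ_{M̄} = χ_M`).  Proof by the similarity `M̃ ~ diag(M, Mᵀ)` over `ℂ` instead of the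
printed eigenvector count. [cite: NetzerThom2012, Lemma 2.13] -/
theorem lemma_2_13 (M : Matrix n n ℂ) (hM : M.IsHermitian) :
    (Matrix.fromBlocks (M.map Complex.re) (M.map Complex.im) (-M.map Complex.im)
        (M.map Complex.re)).charpoly.map (algebraMap ℝ ℂ) = M.charpoly ^ 2 := by
  rw [← Matrix.charpoly_map, doubling_map_eq_conj M hM, Matrix.mul_assoc, Matrix.charpoly_mul_comm,
    Matrix.mul_assoc, Matrix.nonsing_inv_mul _ isUnit_det_P, Matrix.mul_one,
    Matrix.charpoly_fromBlocks_zero₁₂, Matrix.charpoly_transpose, sq]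

/-- **Netzer–Thom 2012, Lemma 2.14 (pointwise / matrix form).** With `M̃` as in Lemma 2.13,
`det M̃ = (det M)²` (both sides read in `ℂ`; `det M` is real for hermitian `M`).  This is
Lemma 2.14, `det 𝓜̃ = (det 𝓜)²`, evaluated at a point `a ∈ ℝⁿ` of a hermitian pencil `𝓜`
(`𝓜(a)` hermitian, `𝓜̃(a) = 𝓜(a)~`); consequently `𝓜̃` and `𝓜` define the same spectrahedron,
"a spectrahedron can always be defined by a symmetric linear matrix polynomial".
TODO(pencil form): the identity `det 𝓜̃ = (det 𝓜)²` in `ℝ[x]` needs the tree's pencil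
vocabulary for complex hermitian coefficients. [cite: NetzerThom2012, Lemma 2.14] -/
theorem lemma_2_14_matrix (M : Matrix n n ℂ) (hM : M.IsHermitian) :
    algebraMap ℝ ℂ (Matrix.fromBlocks (M.map Complex.re) (M.map Complex.im) (-M.map Complex.im)
        (M.map Complex.re)).det = M.det ^ 2 := by
  rw [RingHom.map_det, RingHom.mapMatrix_apply, doubling_map_eq_conj M hM,
    Matrix.det_conj ((Matrix.isUnit_iff_isUnit_det _).mpr isUnit_det_P),
    Matrix.det_fromBlocks_zero₁₂, Matrix.det_transpose, sq]

/-- **Netzer–Thom 2012, Lemma 2.14 (pencil form, read over `ℂ`).** Let `𝓜 = I + ∑ xᵢMᵢ` be a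
hermitian linear matrix polynomial of size `k`, `Mᵢ = Rᵢ + iSᵢ`, and `𝓜̃ = I + ∑ xᵢM̃ᵢ` its real
symmetric doubling of size `2k` (`M̃ᵢ = [[Rᵢ, Sᵢ], [−Sᵢ, Rᵢ]]`).  Then `det 𝓜̃ = (det 𝓜)²` as
polynomials (here: the real polynomial `det 𝓜̃ = monicPencilDet M̃`, mapped into `ℂ[x]`, equals
the square of the complex pencil determinant `det (I + ∑ xᵢMᵢ) ∈ ℂ[x]`).  Proof: the similarity
`M̃ᵢ ~ diag(Mᵢ, Mᵢᵀ)` of Lemma 2.13 is simultaneous in `i`, so at every complex point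
`det 𝓜̃(x) = det 𝓜(x) · det 𝓜(x)ᵀ`; conclude by `MvPolynomial.funext`.  (The printed proof
argues through Prop. 2.1 along real lines.) [cite: NetzerThom2012, Lemma 2.14] -/
theorem lemma_2_14 {ι : Type*} [Fintype ι] (M : ι → Matrix n n ℂ) (hM : ∀ i, (M i).IsHermitian) :
    MvPolynomial.map (algebraMap ℝ ℂ) (monicPencilDet fun i =>
        Matrix.fromBlocks ((M i).map Complex.re) ((M i).map Complex.im) (-(M i).map Complex.im)
          ((M i).map Complex.re)) =
      (Matrix.det (1 + ∑ i, (MvPolynomial.X i : MvPolynomial ι ℂ) • (M i).map MvPolynomial.C)) ^ 2 := by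
  refine MvPolynomial.funext fun x => ?_
  set P : Matrix (n ⊕ n) (n ⊕ n) ℂ := Matrix.fromBlocks (1 : Matrix n n ℂ) (1 : Matrix n n ℂ)
    (Complex.I • (1 : Matrix n n ℂ)) (-(Complex.I • (1 : Matrix n n ℂ))) with hP
  have hPdet : IsUnit P.det := isUnit_det_P
  have hPu : IsUnit P := (Matrix.isUnit_iff_isUnit_det _).mpr hPdet
  have hi : ∀ i, (Matrix.fromBlocks ((M i).map Complex.re) ((M i).map Complex.im)
      (-(M i).map Complex.im) ((M i).map Complex.re)).map (algebraMap ℝ ℂ) =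
      P * Matrix.fromBlocks (M i) 0 0 (M i)ᵀ * P⁻¹ := fun i => doubling_map_eq_conj (M i) (hM i)
  set X : Matrix n n ℂ := 1 + ∑ i, x i • M i with hX
  -- evaluate the left-hand side at the complex point `x`
  have hL : MvPolynomial.eval x (MvPolynomial.map (algebraMap ℝ ℂ) (monicPencilDet fun i =>
        Matrix.fromBlocks ((M i).map Complex.re) ((M i).map Complex.im) (-(M i).map Complex.im)
          ((M i).map Complex.re))) =
      Matrix.det (1 + ∑ i, x i • (P * Matrix.fromBlocks (M i) 0 0 (M i)ᵀ * P⁻¹)) := by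
    simp_rw [← hi]
    rw [MvPolynomial.eval_map, monicPencilDet, ← MvPolynomial.coe_eval₂Hom, RingHom.map_det,
      RingHom.mapMatrix_apply]
    congr 1
    ext a b
    by_cases h : a = b
    · subst h
      simp [Matrix.sum_apply]
    · simp [h, Matrix.sum_apply]
  -- evaluate the right-hand side
  have hR : MvPolynomial.eval x ((Matrix.det (1 + ∑ i, (MvPolynomial.X i : MvPolynomial ι ℂ) •
      (M i).map MvPolynomial.C)) ^ 2) = X.det ^ 2 := by
    rw [map_pow, RingHom.map_det, RingHom.mapMatrix_apply]
    congr 2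
    ext a b
    by_cases h : a = b
    · subst h
      simp [hX, Matrix.sum_apply]
    · simp [h, hX, Matrix.sum_apply]
  -- simultaneous similarity
  have hconj : (1 : Matrix (n ⊕ n) (n ⊕ n) ℂ) + ∑ i, x i • (P * Matrix.fromBlocks (M i) 0 0 (M i)ᵀ * P⁻¹)
      = P * Matrix.fromBlocks X 0 0 Xᵀ * P⁻¹ := by
    have hY : Matrix.fromBlocks X 0 0 Xᵀ =
        1 + ∑ i, x i • Matrix.fromBlocks (M i) (0 : Matrix n n ℂ) 0 (M i)ᵀ := by
      ext (a | a) (b | b)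
      · simp [hX, Matrix.sum_apply, Matrix.one_apply]
      · simp [Matrix.sum_apply]
      · simp [Matrix.sum_apply]
      · simp [hX, Matrix.sum_apply, Matrix.one_apply]
    rw [hY, Matrix.mul_add, Matrix.add_mul, Matrix.mul_one, Matrix.mul_nonsing_inv _ hPdet,
      Matrix.mul_sum, Matrix.sum_mul]
    congr 1
    exact Finset.sum_congr rfl fun i _ => by rw [Matrix.mul_smul, Matrix.smul_mul]
  rw [hL, hR, hconj, Matrix.det_conj hPu, Matrix.det_fromBlocks_zero₁₂, Matrix.det_transpose, sq]

end Lemma213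

/-! ## The hermitian forms of Prop. 2.1, Cor. 2.3 and Thm. 2.4

The paper works with complex hermitian pencils `𝓜 = I + ∑ xᵢMᵢ`, `Mᵢ ∈ H_k(ℂ)`; its determinant
is written here, without introducing a new definition, as the complex polynomial
`det (1 + ∑ xᵢ • Mᵢ) ∈ ℂ[x]` (`Matrix.det (1 + ∑ i, X i • (M i).map C)`), restricted to *real*
lines `x = t a`, `a ∈ ℝⁿ` (so that `∑ aᵢMᵢ` is hermitian). -/

section Hermitian

variable {ι : Type*} [Fintype ι] {k : Type*} [Fintype k] [DecidableEq k]

/-- Spectral factorisation for complex hermitian `W`: `det (I + tW) = ∏ (λᵢ t + 1)` in `ℂ[t]`.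
[cite: NetzerThom2012, Prop. 2.1 (proof)] -/
theorem lineDet_eq_prod_of_isHermitian (W : Matrix k k ℂ) (hW : W.IsHermitian) :
    lineDet W = ∏ i, (C (hW.eigenvalues i : ℂ) * X + 1) := by
  set U : Matrix k k ℂ := (hW.eigenvectorUnitary : Matrix k k ℂ) with hU
  have hspec : W = U * diagonal (fun i => (hW.eigenvalues i : ℂ)) * star U := by
    have h := hW.spectral_theorem
    rw [Unitary.conjStarAlgAut_apply] at h
    simpa [Function.comp_def] using h
  have hunit : U * star U = 1 := Matrix.mem_unitaryGroup_iff.mp (hW.eigenvectorUnitary).2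
  set Uc : Matrix k k ℂ[X] := U.map C with hUc
  set Vc : Matrix k k ℂ[X] := (star U).map C with hVc
  have hUV : Uc * Vc = 1 := by
    rw [hUc, hVc, ← Matrix.map_mul, hunit, Matrix.map_one C C_0 C_1]
  have hWc : W.map C = Uc * diagonal (fun i => C (hW.eigenvalues i : ℂ)) * Vc := by
    conv_lhs => rw [hspec]
    rw [Matrix.map_mul, Matrix.map_mul, diagonal_map (map_zero C)]
  have hdiag : diagonal (fun i => C (hW.eigenvalues i : ℂ) * X + 1)
      = 1 + (X : ℂ[X]) • diagonal (fun i => C (hW.eigenvalues i : ℂ)) := by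
    ext i j
    by_cases h : i = j
    · subst h
      simp only [diagonal_apply_eq, Matrix.add_apply, Matrix.one_apply_eq, Matrix.smul_apply,
        smul_eq_mul]
      ring
    · simp [h]
  have key : (1 : Matrix k k ℂ[X]) + (X : ℂ[X]) • W.map C =
      Uc * diagonal (fun i => C (hW.eigenvalues i : ℂ) * X + 1) * Vc := by
    rw [hWc, hdiag, Matrix.mul_add, Matrix.add_mul, Matrix.mul_one, hUV, Matrix.mul_smul,
      Matrix.smul_mul]
  have hdet : Uc.det * Vc.det = 1 := by rw [← det_mul, hUV, det_one]
  rw [lineDet, key, det_mul, det_mul, det_diagonal]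
  calc Uc.det * (∏ i, (C (hW.eigenvalues i : ℂ) * X + 1)) * Vc.det
      = (∏ i, (C (hW.eigenvalues i : ℂ) * X + 1)) * (Uc.det * Vc.det) := by ring
    _ = ∏ i, (C (hW.eigenvalues i : ℂ) * X + 1) := by rw [hdet, mul_one]

/-- For complex hermitian `W`, `deg det (I + tW)` is the number of non-zero eigenvalues, hence
`rank W = deg det (I + tW)`. [cite: NetzerThom2012, Prop. 2.1 / Cor. 2.3 (proof)] -/
theorem rank_eq_natDegree_lineDet_of_isHermitian (W : Matrix k k ℂ) (hW : W.IsHermitian) :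
    W.rank = (lineDet W).natDegree := by
  classical
  have hne : ∀ i, (C (hW.eigenvalues i : ℂ) * X + 1 : ℂ[X]) ≠ 0 := fun i h => by
    have h1 := congr_arg (Polynomial.eval 0) h
    simp at h1
  have hdeg : ∀ i, (C (hW.eigenvalues i : ℂ) * X + 1 : ℂ[X]).natDegree =
      if hW.eigenvalues i ≠ 0 then 1 else 0 := fun i => by
    split_ifs with h
    · have h' : (hW.eigenvalues i : ℂ) ≠ 0 := by exact_mod_cast h
      rw [← C_1, Polynomial.natDegree_linear h']
    · rw [not_not] at h
      simp [h]
  rw [hW.rank_eq_card_non_zero_eigs, lineDet_eq_prod_of_isHermitian W hW,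
    Polynomial.natDegree_prod _ _ fun i _ => hne i]
  simp_rw [hdeg]
  rw [Finset.sum_boole, Fintype.card_subtype]
  simp

/-- **Prop. 2.1 (hermitian form).** For complex hermitian `W` the roots of `det (I + tW) ∈ ℂ[t]`
are the `−1/μ`, `μ` over the non-zero (real) eigenvalues of `W`, with multiplicity.
[cite: NetzerThom2012, Prop. 2.1] -/
theorem roots_lineDet_eq_of_isHermitian (W : Matrix k k ℂ) (hW : W.IsHermitian) :
    (lineDet W).roots = (W.charpoly.roots.filter (· ≠ 0)).map fun μ => -μ⁻¹ := by
  classical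
  have hne : ∀ i, (C (hW.eigenvalues i : ℂ) * X + 1 : ℂ[X]) ≠ 0 := fun i h => by
    have h1 := congr_arg (Polynomial.eval 0) h
    simp at h1
  have hroots : ∀ c : ℂ, (C c * X + 1 : ℂ[X]).roots = if c ≠ 0 then {-c⁻¹} else 0 := fun c => by
    split_ifs with h
    · rw [← C_1, Polynomial.roots_C_mul_X_add_C 1 h, mul_one]
    · rw [not_not] at h
      simp [h]
  rw [lineDet_eq_prod_of_isHermitian W hW, Polynomial.roots_prod _ _
      (Finset.prod_ne_zero_iff.mpr fun i _ => hne i), hW.roots_charpoly_eq_eigenvalues]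
  simp_rw [hroots]
  rw [bind_ite_singleton, Multiset.filter_map, Multiset.map_map]
  rfl

/-- A real linear combination of hermitian matrices is hermitian. [folklore] -/
private theorem isHermitian_sum_ofReal_smul {l : Type*} (M : ι → Matrix l l ℂ)
    (hM : ∀ i, (M i).IsHermitian) (a : ι → ℝ) : (∑ i, (a i : ℂ) • M i).IsHermitian := by
  unfold Matrix.IsHermitian
  rw [conjTranspose_sum]
  exact Finset.sum_congr rfl fun i _ => by
    rw [conjTranspose_smul, (hM i).eq, Complex.star_def, Complex.conj_ofReal]

/-- Restriction of the hermitian pencil determinant `det (I + ∑ xᵢMᵢ) ∈ ℂ[x]` to the real line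
`x = t a`: it is `det (I + t ∑ aᵢMᵢ)`. [cite: NetzerThom2012, Prop. 2.1] -/
theorem linePoly_det_pencil_zero (M : ι → Matrix k k ℂ) (a : ι → ℝ) :
    linePoly (Matrix.det (1 + ∑ i, (MvPolynomial.X i : MvPolynomial ι ℂ) •
        (M i).map (MvPolynomial.C : ℂ →+* MvPolynomial ι ℂ))) 0 (fun i => (a i : ℂ)) = lineDet (∑ i, (a i : ℂ) • M i) := by
  rw [linePoly, lineDet, AlgHom.map_det, AlgHom.mapMatrix_apply]
  congr 1
  refine Matrix.ext fun j l => ?_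
  have hsum : ∑ i, C (a i : ℂ) * X * C (M i j l) = X * C ((∑ i, (a i : ℂ) • M i) j l) := by
    rw [Matrix.sum_apply, map_sum, Finset.mul_sum]
    exact Finset.sum_congr rfl fun i _ => by rw [Matrix.smul_apply, smul_eq_mul, map_mul]; ring
  by_cases h : j = l
  · subst h
    simpa [Matrix.sum_apply, Polynomial.algebraMap_eq] using hsum
  · simpa [h, Matrix.sum_apply, Polynomial.algebraMap_eq] using hsum

/-- **Prop. 2.1 (hermitian pencils, as printed).** For a hermitian pencil `𝓜 = I + ∑ xᵢMᵢ` and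
`a ∈ ℝⁿ`, the zeros of `p_a(t) = det 𝓜(t a)` are the `−1/λ`, `λ` over the non-zero eigenvalues
of `∑ aᵢMᵢ`, with multiplicity. [cite: NetzerThom2012, Prop. 2.1] -/
theorem prop_2_1_hermitian (M : ι → Matrix k k ℂ) (hM : ∀ i, (M i).IsHermitian) (a : ι → ℝ) :
    (linePoly (Matrix.det (1 + ∑ i, (MvPolynomial.X i : MvPolynomial ι ℂ) •
        (M i).map (MvPolynomial.C : ℂ →+* MvPolynomial ι ℂ))) 0 (fun i => (a i : ℂ))).roots =
      ((∑ i, (a i : ℂ) • M i).charpoly.roots.filter (· ≠ 0)).map fun μ => -μ⁻¹ := by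
  rw [linePoly_det_pencil_zero]
  exact roots_lineDet_eq_of_isHermitian _ (isHermitian_sum_ofReal_smul M hM a)

/-- **Cor. 2.3 (hermitian form).** For a hermitian pencil with determinant `p ∈ ℂ[x]` and real
`a`, `rank (∑ aᵢMᵢ) = deg p_a ≤ deg p`. [cite: NetzerThom2012, Cor. 2.3] -/
theorem cor_2_3_hermitian (M : ι → Matrix k k ℂ) (hM : ∀ i, (M i).IsHermitian) (a : ι → ℝ) :
    (∑ i, (a i : ℂ) • M i).rank ≤ (Matrix.det (1 + ∑ i, (MvPolynomial.X i : MvPolynomial ι ℂ) •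
        (M i).map (MvPolynomial.C : ℂ →+* MvPolynomial ι ℂ))).totalDegree := by
  rw [rank_eq_natDegree_lineDet_of_isHermitian _ (isHermitian_sum_ofReal_smul M hM a),
    ← linePoly_det_pencil_zero]
  exact natDegree_linePoly_le_totalDegree _ _ _

/-- Cor. 2.3 (hermitian form) for the coefficient matrices: `rank Mᵢ ≤ deg p`.
[cite: NetzerThom2012, Cor. 2.3] -/
theorem rank_le_totalDegree_hermitian (M : ι → Matrix k k ℂ) (hM : ∀ i, (M i).IsHermitian)
    (i : ι) : (M i).rank ≤ (Matrix.det (1 + ∑ i, (MvPolynomial.X i : MvPolynomial ι ℂ) •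
        (M i).map (MvPolynomial.C : ℂ →+* MvPolynomial ι ℂ))).totalDegree := by
  classical
  have h := cor_2_3_hermitian M hM (Pi.single i 1)
  rwa [Fintype.sum_eq_single i (fun j hj => by rw [Pi.single_eq_of_ne hj, Complex.ofReal_zero,
    zero_smul]), Pi.single_eq_same, Complex.ofReal_one, one_smul] at h

/-- Corner compression for hermitian pencils: if `MᵢQQᴴ = Mᵢ` for all `i` then
`det (I + ∑ xᵢQᴴMᵢQ) = det (I + ∑ xᵢMᵢ)`. [cite: NetzerThom2012, proof of Thm. 2.4 and Rem. 2.5] -/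
theorem det_pencil_conj_hermitian {m : Type*} [Fintype m] [DecidableEq m]
    (M : ι → Matrix k k ℂ) (Q : Matrix k m ℂ) (hQ : ∀ i, M i * (Q * Qᴴ) = M i) :
    Matrix.det (1 + ∑ i, (MvPolynomial.X i : MvPolynomial ι ℂ) • (Qᴴ * M i * Q).map (MvPolynomial.C : ℂ →+* MvPolynomial ι ℂ))
      = Matrix.det (1 + ∑ i, (MvPolynomial.X i : MvPolynomial ι ℂ) • (M i).map (MvPolynomial.C : ℂ →+* MvPolynomial ι ℂ)) := by
  set Qc : Matrix k m (MvPolynomial ι ℂ) := Q.map MvPolynomial.C with hQc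
  set Qh : Matrix m k (MvPolynomial ι ℂ) := Qᴴ.map MvPolynomial.C with hQh
  set S : Matrix k k (MvPolynomial ι ℂ) :=
    ∑ i, (MvPolynomial.X i : MvPolynomial ι ℂ) • (M i).map (MvPolynomial.C : ℂ →+* MvPolynomial ι ℂ) with hS
  have h1 : ∑ i, (MvPolynomial.X i : MvPolynomial ι ℂ) • (Qᴴ * M i * Q).map MvPolynomial.C
      = Qh * (S * Qc) := by
    rw [hS, Matrix.sum_mul, Matrix.mul_sum]
    refine Finset.sum_congr rfl fun i _ => ?_
    rw [Matrix.map_mul, Matrix.map_mul, ← hQc, ← hQh]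
    simp only [Matrix.smul_mul, Matrix.mul_smul, Matrix.mul_assoc]
  have h2 : S * (Qc * Qh) = S := by
    rw [hS, Matrix.sum_mul]
    refine Finset.sum_congr rfl fun i _ => ?_
    rw [Matrix.smul_mul, hQc, hQh, ← Matrix.map_mul, ← Matrix.map_mul, hQ i]
  rw [h1, Matrix.det_one_add_mul_comm, Matrix.mul_assoc, h2]

/-- A vector killed by `∑ Mᵢ²`, `Mᵢ` hermitian, is killed by every `Mᵢ` (`u*(∑Mᵢ²)u = ∑ ‖Mᵢu‖²`).
[folklore] -/
private theorem mulVec_eq_zero_of_sum_mul_self_hermitian {l : Type*} [Fintype l]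
    (M : ι → Matrix l l ℂ) (hM : ∀ i, (M i).IsHermitian) (u : l → ℂ)
    (hu : (∑ i, M i * M i) *ᵥ u = 0) (i : ι) : M i *ᵥ u = 0 := by
  have key : ∀ j, star u ⬝ᵥ ((M j * M j) *ᵥ u) =
      ((∑ a, Complex.normSq ((M j *ᵥ u) a) : ℝ) : ℂ) := fun j => by
    rw [← mulVec_mulVec, dotProduct_mulVec, ← (hM j).eq, ← star_mulVec, (hM j).eq, Complex.ofReal_sum]
    simp only [dotProduct, Pi.star_apply, Complex.star_def, Complex.normSq_eq_conj_mul_self]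
  have h0 : ((∑ j, ∑ a, Complex.normSq ((M j *ᵥ u) a) : ℝ) : ℂ) = 0 := by
    have h := congr_arg (fun v => star u ⬝ᵥ v) hu
    simpa only [Matrix.sum_mulVec, dotProduct_sum, key, dotProduct_zero, Complex.ofReal_sum] using h
  have h1 : ∑ j, ∑ a, Complex.normSq ((M j *ᵥ u) a) = 0 := by exact_mod_cast h0
  have h2 := (Finset.sum_eq_zero_iff_of_nonneg fun j _ =>
    Finset.sum_nonneg fun a _ => Complex.normSq_nonneg _).mp h1 i (Finset.mem_univ i)
  have h3 := (Finset.sum_eq_zero_iff_of_nonneg fun a _ => Complex.normSq_nonneg _).mp h2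
  funext a
  exact Complex.normSq_eq_zero.mp (h3 a (Finset.mem_univ a))

/-- **Compression lemma, hermitian form (proof of Thm. 2.4).** For hermitian `M₁, …, Mₘ` of size
`k` and `N ≥ ∑ rank Mᵢ` there is a `k × N` complex matrix `Q` with `MᵢQQᴴ = Mᵢ` for all `i`
(eigenvector columns of `∑ Mᵢ²` with non-zero eigenvalue, padded), so the hermitian corner pencil
`I + ∑ xᵢQᴴMᵢQ` of size `N` has the same determinant (`det_pencil_conj_hermitian`); the printed
proof splits off `⋂ ker Mᵢ` by a unitary base change. [cite: NetzerThom2012, proof of Thm. 2.4] -/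
theorem exists_mul_conjTranspose_mul_eq (M : ι → Matrix k k ℂ) (hM : ∀ i, (M i).IsHermitian)
    {N : ℕ} (hN : ∑ i, (M i).rank ≤ N) :
    ∃ Q : Matrix k (Fin N) ℂ, ∀ i, M i * (Q * Qᴴ) = M i := by
  classical
  set S : Matrix k k ℂ := ∑ i, M i * M i with hSdef
  have hS : S.IsHermitian := by
    unfold Matrix.IsHermitian
    rw [hSdef, conjTranspose_sum]
    exact Finset.sum_congr rfl fun i _ => by rw [conjTranspose_mul, (hM i).eq]
  set U : Matrix k k ℂ := (hS.eigenvectorUnitary : Matrix k k ℂ) with hU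
  have hUU : U * Uᴴ = 1 := by
    have h := Matrix.mem_unitaryGroup_iff.mp (hS.eigenvectorUnitary).2
    rwa [star_eq_conjTranspose] at h
  have hker : ∀ j, hS.eigenvalues j = 0 → ∀ i, M i *ᵥ (Uᵀ j) = 0 := by
    intro j hj i
    have h1 : S *ᵥ (Uᵀ j) = 0 := by
      rw [hU, Matrix.IsHermitian.eigenvectorUnitary_transpose_apply, hS.mulVec_eigenvectorBasis j,
        hj, zero_smul]
    rw [hSdef] at h1
    exact mulVec_eq_zero_of_sum_mul_self_hermitian M hM _ h1 i
  have hcard : Fintype.card {j : k // hS.eigenvalues j ≠ 0} ≤ Fintype.card (Fin N) := by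
    rw [Fintype.card_fin, ← hS.rank_eq_card_non_zero_eigs]
    calc S.rank ≤ ∑ i, (M i * M i).rank := rank_sum_le _ _
      _ ≤ ∑ i, (M i).rank := Finset.sum_le_sum fun i _ => Matrix.rank_mul_le_left _ _
      _ ≤ N := hN
  obtain ⟨f⟩ := Function.Embedding.nonempty_of_card_le hcard
  let Q₁ : Matrix k {j : k // hS.eigenvalues j ≠ 0} ℂ := fun a j => U a j
  let Q₀ : Matrix k {j : k // ¬ hS.eigenvalues j ≠ 0} ℂ := fun a j => U a j
  let Q₂ : Matrix {j : k // hS.eigenvalues j ≠ 0} (Fin N) ℂ := fun j b => if f j = b then 1 else 0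
  have hsplit : U * Uᴴ = Q₁ * Q₁ᴴ + Q₀ * Q₀ᴴ := by
    ext a b
    simp only [Matrix.mul_apply, Matrix.add_apply, Matrix.conjTranspose_apply, Q₁, Q₀]
    exact (Fintype.sum_subtype_add_sum_subtype (fun j => hS.eigenvalues j ≠ 0)
      (fun j => U a j * star (U b j))).symm
  have hQ₀ : ∀ i, M i * Q₀ = 0 := fun i => by
    ext a j
    have h := congr_fun (hker j.1 (not_not.mp j.2) i) a
    simpa [Q₀, Matrix.mul_apply, Matrix.mulVec, dotProduct] using h
  have hQ₁ : ∀ i, M i * (Q₁ * Q₁ᴴ) = M i := fun i => by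
    have h : M i * (U * Uᴴ) = M i * (Q₁ * Q₁ᴴ) + M i * Q₀ * Q₀ᴴ := by
      rw [hsplit, Matrix.mul_add, Matrix.mul_assoc]
    rw [hUU, Matrix.mul_one, hQ₀ i, Matrix.zero_mul, add_zero] at h
    exact h.symm
  have hQ₂ : Q₂ * Q₂ᴴ = 1 := by
    ext j j'
    simp [Q₂, Matrix.mul_apply, Matrix.one_apply, f.injective.eq_iff, eq_comm, apply_ite star]
  refine ⟨Q₁ * Q₂, fun i => ?_⟩
  have hassoc : Q₁ * Q₂ * (Q₁ * Q₂)ᴴ = Q₁ * (Q₂ * Q₂ᴴ) * Q₁ᴴ := by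
    rw [conjTranspose_mul]
    simp only [Matrix.mul_assoc]
  rw [hassoc, hQ₂, Matrix.mul_one, hQ₁ i]

/-- **Netzer–Thom 2012, Thm. 2.4 (hermitian case), pencil form.** A hermitian monic pencil
`I + ∑ xᵢMᵢ` (any size) whose determinant has degree `≤ d` has a hermitian corner pencil
`I + ∑ xᵢQᴴMᵢQ` of size exactly `n·d` with the same determinant, `MᵢQQᴴ = Mᵢ` (Rem. 2.5).
[cite: NetzerThom2012, Thm. 2.4 and Rem. 2.5] -/
theorem thm_2_4_hermitian_pencil (M : ι → Matrix k k ℂ) (hM : ∀ i, (M i).IsHermitian) {d : ℕ}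
    (hd : (Matrix.det (1 + ∑ i, (MvPolynomial.X i : MvPolynomial ι ℂ) •
        (M i).map (MvPolynomial.C : ℂ →+* MvPolynomial ι ℂ))).totalDegree ≤ d) :
    ∃ Q : Matrix k (Fin (Fintype.card ι * d)) ℂ,
      (∀ i, M i * (Q * Qᴴ) = M i) ∧ (∀ i, (Qᴴ * M i * Q).IsHermitian) ∧
        Matrix.det (1 + ∑ i, (MvPolynomial.X i : MvPolynomial ι ℂ) •
            (Qᴴ * M i * Q).map (MvPolynomial.C : ℂ →+* MvPolynomial ι ℂ)) =
          Matrix.det (1 + ∑ i, (MvPolynomial.X i : MvPolynomial ι ℂ) • (M i).map (MvPolynomial.C : ℂ →+* MvPolynomial ι ℂ)) := by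
  have hN : ∑ i, (M i).rank ≤ Fintype.card ι * d :=
    calc ∑ i, (M i).rank ≤ ∑ _i : ι, d :=
          Finset.sum_le_sum fun i _ => (rank_le_totalDegree_hermitian M hM i).trans hd
      _ = Fintype.card ι * d := by rw [Finset.sum_const, smul_eq_mul, Finset.card_univ]
  obtain ⟨Q, hQ⟩ := exists_mul_conjTranspose_mul_eq M hM hN
  exact ⟨Q, hQ, fun i => Matrix.isHermitian_conjTranspose_mul_mul Q (hM i),
    det_pencil_conj_hermitian M Q hQ⟩

/-- **Netzer–Thom 2012, Thm. 2.4 (hermitian case).** If `p ∈ ℂ[x₁, …, xₙ]` (a real zero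
polynomial with real coefficients, automatically: `rem_2_2_i_hermitian`) is the determinant of a
hermitian monic pencil
`I + x₁M₁ + ⋯ + xₙMₙ` of some size and `deg p ≤ d`, then `p` is the determinant of a hermitian monic
pencil of size `n·d`.  Together with `thm_2_4` this is the printed "symmetric/hermitian"
statement. [cite: NetzerThom2012, Thm. 2.4] -/
theorem thm_2_4_hermitian (p : MvPolynomial ι ℂ) {d : ℕ} (hd : p.totalDegree ≤ d)
    (M : ι → Matrix k k ℂ) (hM : ∀ i, (M i).IsHermitian)
    (hp : Matrix.det (1 + ∑ i, (MvPolynomial.X i : MvPolynomial ι ℂ) • (M i).map (MvPolynomial.C : ℂ →+* MvPolynomial ι ℂ)) = p) :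
    ∃ M' : ι → Matrix (Fin (Fintype.card ι * d)) (Fin (Fintype.card ι * d)) ℂ,
      (∀ i, (M' i).IsHermitian) ∧
        Matrix.det (1 + ∑ i, (MvPolynomial.X i : MvPolynomial ι ℂ) • (M' i).map (MvPolynomial.C : ℂ →+* MvPolynomial ι ℂ))
          = p := by
  subst hp
  obtain ⟨Q, -, hh, hdet⟩ := thm_2_4_hermitian_pencil M hM hd
  exact ⟨fun i => Qᴴ * M i * Q, hh, hdet⟩

end Hermitian

/-! ## The introduction's dictionary: spectrahedra are rigidly convex sets -/

section Spectrahedron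

variable {ι : Type*} [Fintype ι] {n : Type*} [Fintype n] [DecidableEq n]

/-- **Netzer–Thom 2012, §1 / Rem. 2.2 (the first Helton–Vinnikov observation), real symmetric
case.** The spectrahedron `S(𝓜) = {a ∈ ℝᵐ : I + ∑ aᵢAᵢ ⪰ 0}` of a real symmetric monic pencil is
the rigidly convex set `S(p) = {a : p_a has no root in [0,1)}` of its determinant
`p = det (I + ∑ xᵢAᵢ)`, which is a real zero polynomial with `p(0) = 1`:
"each spectrahedron is of the form `S(p)` for an RZ-polynomial `p`".
[cite: NetzerThom2012, §1 (p. 2) and Rem. 2.2] -/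
theorem spectrahedron_eq_rigidlyConvexSet (A : ι → Matrix n n ℝ) (hA : ∀ i, (A i).IsSymm) :
    IsRZPoly (monicPencilDet A) ∧ MvPolynomial.eval 0 (monicPencilDet A) = 1 ∧
      {a : ι → ℝ | (1 + ∑ i, a i • A i).PosSemidef} =
        {a : ι → ℝ | ∀ t : ℝ, 0 ≤ t → t < 1 → ¬ (linePoly (monicPencilDet A) 0 a).IsRoot t} :=
  ⟨isRZPoly_monicPencilDet A hA, eval_zero_monicPencilDet A,
    Set.ext fun a => rem_2_2_ii A hA a⟩

/-- **Example 2.16 (the hermitian `2 × 2` representation of `p₃`).** The quadratic RZ polynomial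
`p₃ = 1 − x₁² − x₂² − x₃²` is the determinant of the hermitian monic pencil
`[[1 + x₃, x₁ + i x₂], [x₁ − i x₂, 1 − x₃]]` of size `2` (the Pauli pencil), although by
Thm. 2.11 it has no *symmetric* representation of size `< 3`; here: the determinant identity,
with the pencil written as `I + x₁σ₁ + x₂σ₂ + x₃σ₃`. [cite: NetzerThom2012, Example 2.16] -/
theorem example_2_16_hermitian :
    Matrix.det (1 + ∑ i : Fin 3, (MvPolynomial.X i : MvPolynomial (Fin 3) ℂ) •
        ((![!![0, 1; 1, 0], !![0, Complex.I; -Complex.I, 0], !![1, 0; 0, -1]] i).map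
          (MvPolynomial.C : ℂ →+* MvPolynomial (Fin 3) ℂ))) =
      1 - ∑ i : Fin 3, MvPolynomial.X i ^ 2 := by
  have hI : (MvPolynomial.C Complex.I : MvPolynomial (Fin 3) ℂ) * MvPolynomial.C Complex.I = -1 := by
    rw [← map_mul, Complex.I_mul_I, map_neg, map_one]
  simp only [Fin.sum_univ_three, Matrix.det_fin_two]
  simp [Matrix.add_apply, Matrix.smul_apply, Matrix.map_apply]
  linear_combination (MvPolynomial.X 1 ^ 2 : MvPolynomial (Fin 3) ℂ) * hI

/-- The three Pauli-type coefficient matrices of `example_2_16_hermitian` are hermitian.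
[cite: NetzerThom2012, Example 2.16] -/
theorem example_2_16_hermitian_isHermitian (i : Fin 3) :
    ((![!![0, 1; 1, 0], !![0, Complex.I; -Complex.I, 0], !![1, 0; 0, -1]] i : Matrix (Fin 2) (Fin 2) ℂ)).IsHermitian := by
  fin_cases i
  · exact Matrix.IsHermitian.ext fun a b => by fin_cases a <;> fin_cases b <;> simp
  · exact Matrix.IsHermitian.ext fun a b => by fin_cases a <;> fin_cases b <;> simp
  · exact Matrix.IsHermitian.ext fun a b => by fin_cases a <;> fin_cases b <;> simp

end Spectrahedron

/-! ## Remark 2.2 (i) for hermitian pencils: `det (I + ∑ xᵢMᵢ)` is a real RZ polynomial -/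

section Rem22Hermitian

variable {ι : Type*} [Fintype ι] {k : Type*} [Fintype k] [DecidableEq k]

open Literature.AlgebraicGeometry.HyperbolicPolynomials (map_linePoly) in
/-- **Netzer–Thom 2012, §1 / Remark 2.2 (i) (hermitian pencils).** The determinant
`p = det (I + x₁M₁ + ⋯ + xₙMₙ)` of a hermitian linear matrix polynomial "is a real polynomial,
both in the hermitian and symmetric case" (§1), "fulfills `p(0) = 1`" and is a real zero polynomial:
"no `p_a` can have a complex zero. Any such zero would give rise to a complex eigenvalue of a
hermitian matrix" (Rem. 2.2 (i)).  Typed: there is `q ∈ ℝ[x]` with `q ↦ p` under `ℝ[x] → ℂ[x]`,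
`q(0) = 1` and `IsRZPoly q`. [cite: NetzerThom2012, §1 (p. 2) and Rem. 2.2 (i)] -/
theorem rem_2_2_i_hermitian (M : ι → Matrix k k ℂ) (hM : ∀ i, (M i).IsHermitian) :
    ∃ q : MvPolynomial ι ℝ, MvPolynomial.map (algebraMap ℝ ℂ) q =
        Matrix.det (1 + ∑ i, (MvPolynomial.X i : MvPolynomial ι ℂ) •
          (M i).map (MvPolynomial.C : ℂ →+* MvPolynomial ι ℂ)) ∧
      MvPolynomial.eval 0 q = 1 ∧ IsRZPoly q := by
  classical
  set p : MvPolynomial ι ℂ := Matrix.det (1 + ∑ i, (MvPolynomial.X i : MvPolynomial ι ℂ) •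
    (M i).map (MvPolynomial.C : ℂ →+* MvPolynomial ι ℂ)) with hp
  -- (1) `p` has real coefficients: conjugating the coefficients transposes the pencil.
  have hconj : MvPolynomial.map (starRingEnd ℂ) p = p := by
    rw [hp, RingHom.map_det, RingHom.mapMatrix_apply]
    have hmat : (1 + ∑ i, (MvPolynomial.X i : MvPolynomial ι ℂ) •
        (M i).map (MvPolynomial.C : ℂ →+* MvPolynomial ι ℂ)).map (MvPolynomial.map (starRingEnd ℂ))
        = (1 + ∑ i, (MvPolynomial.X i : MvPolynomial ι ℂ) •
            (M i).map (MvPolynomial.C : ℂ →+* MvPolynomial ι ℂ))ᵀ := by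
      ext a b
      have hab : ∀ i, (starRingEnd ℂ) (M i a b) = M i b a := fun i => (hM i).apply b a
      by_cases h : a = b
      · subst h
        simp [Matrix.sum_apply, MvPolynomial.map_X, MvPolynomial.map_C, hab]
      · have h' : ¬ b = a := fun e => h e.symm
        simp [Matrix.sum_apply, MvPolynomial.map_X, MvPolynomial.map_C, hab, h, h']
    rw [hmat, Matrix.det_transpose]
  have hreal : ∀ m, ((p.coeff m).re : ℂ) = p.coeff m := fun m => by
    have h := congr_arg (MvPolynomial.coeff m) hconj
    rw [MvPolynomial.coeff_map] at h
    exact Complex.conj_eq_iff_re.mp h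
  -- (2) the real polynomial `q`
  set q : MvPolynomial ι ℝ := ∑ m ∈ p.support, MvPolynomial.monomial m (p.coeff m).re with hq
  have hqp : MvPolynomial.map (algebraMap ℝ ℂ) q = p := by
    rw [hq, map_sum]
    simp_rw [MvPolynomial.map_monomial, Complex.coe_algebraMap, hreal]
    exact (MvPolynomial.as_sum p).symm
  refine ⟨q, hqp, ?_, ?_⟩
  · -- `q(0) = 1`
    have h0 : MvPolynomial.constantCoeff p = 1 := by
      rw [← MvPolynomial.eval_zero, hp, RingHom.map_det, RingHom.mapMatrix_apply]
      have : (1 + ∑ i, (MvPolynomial.X i : MvPolynomial ι ℂ) •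
          (M i).map (MvPolynomial.C : ℂ →+* MvPolynomial ι ℂ)).map (MvPolynomial.eval 0) = 1 := by
        ext a b
        by_cases h : a = b
        · subst h; simp [Matrix.sum_apply]
        · simp [h, Matrix.sum_apply]
      rw [this, Matrix.det_one]
    have h1 : ((MvPolynomial.constantCoeff q : ℝ) : ℂ) = 1 := by
      rw [← Complex.coe_algebraMap, ← MvPolynomial.constantCoeff_map, hqp, h0]
    rw [MvPolynomial.eval_zero]
    exact_mod_cast h1
  · -- `q` is RZ: along a real line its complexification is `det (I + t ∑ aᵢMᵢ) = ∏ (λᵢ t + 1)`.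
    intro w
    set W : Matrix k k ℂ := ∑ i, (w i : ℂ) • M i with hW
    have hWh : W.IsHermitian := isHermitian_sum_ofReal_smul M hM w
    have hmap : (linePoly q 0 w).map (algebraMap ℝ ℂ) =
        (∏ i, (C (hWh.eigenvalues i) * X + 1)).map (algebraMap ℝ ℂ) := by
      rw [map_linePoly, hqp]
      have h0 : ((algebraMap ℝ ℂ) ∘ (0 : ι → ℝ)) = 0 := by funext i; simp
      have hw : ((algebraMap ℝ ℂ) ∘ w) = fun i => (w i : ℂ) := by funext i; simp
      rw [h0, hw, hp, linePoly_det_pencil_zero, ← hW, lineDet_eq_prod_of_isHermitian W hWh,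
        Polynomial.map_prod]
      refine Finset.prod_congr rfl fun i _ => ?_
      simp [Polynomial.map_add, Polynomial.map_mul]
    have heq : linePoly q 0 w = ∏ i, (C (hWh.eigenvalues i) * X + 1) :=
      Polynomial.map_injective _ (algebraMap ℝ ℂ).injective hmap
    rw [heq]
    refine Polynomial.Splits.prod fun i _ => Polynomial.Splits.of_degree_le_one ?_
    rw [← C_1]
    exact Polynomial.degree_linear_le

end Rem22Hermitian

end Literature.AlgebraicGeometry.DeterminantalHypersurfaces.NetzerThom2012

end
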